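import Summits.MatrixMultiplication.MatrixMultiplication.Theses.LevelGradedCohnUmans
import Summits.MatrixMultiplication.MatrixMultiplication.Theorems.LieRankDesigns.Negative.Basics
import Summits.MatrixMultiplication.MatrixMultiplication.Cruxes.LieRankDesigns.Disproof
import Literature.Computability.AlgebraicComplexity.LandsbergRessayreNormalForm

/-!
# Disproof work file for the crux `LieRankBeatsCubes` (stmt-MatrixMultiplication-14057)

Standing adversary file (cdisprove seat `refuter-cdisprove-stmt-MatrixMultiplication-14057-0`).  Prose lives
in docstrings; every `theorem` is kernel-checked (rc 0, no `sorry`) unless it sits in the final `NearMisses`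
section.  Vocabulary (`GLm`, `Mat`, `fourierFn`, `RankSupp`, `RankSep`, `levelSet`, `budget`, `volume`,
`levelSubmodule`, `RankLE`, …) is the sibling crux's (`Cruxes/LieRankDesigns/Disproof.lean`, importable and
sorry-free; its part A is landed as `Theorems/LieRankDesigns/Negative/Basics.lean`), and the crux unfolds to it
by `Iff.rfl` (`lieRankBeatsCubes_iff`).

## Verdict so far
NO KILL of the crux as a whole — and an unconditional `¬ LieRankBeatsCubes` is out of reach for a structural
reason proved below (`topLevel_slice_iff`): the cells `k ≥ m` of the crux are LITERALLY Cohn–Umans' "beat the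
sum of the cubes inside `GL_m(𝔽_p)`" (`RankSep k ↔ TPP`, budget = full `Σ_{Irr} d³`), an open problem not
excluded by any catalogued barrier (the quasirandom cap exceeds `Σd³` by `√p`).
BUT THE PREMISE OF THE DECLARED FIRST RUNG IS REFUTED: the crux text frames the `(2,1)` rung as "beat the
prime-field frontier `(Aff⁺, T, U⁻)`, `V = p²(p−1)² = B₃ − 4p³ + O(p²)`, by the factor `1 + 4/p` with linear
separation" — that triple (TPP, volume `|G|·p/(p+1)`) is NOT rank-1 separated for any odd `p`
(`not_rankSep_affPlus_torusTwo_uMinus`, `not_rankSep_borelConfiguration`; mechanism: LDU-rectangle circuits of the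
level-one matroid), so it certifies nothing at the graded budget; the largest VERIFIED rank-1 designs of this type
have `V = p²(p−1) ≈ |G|/p` (`(U⁻, T₁, U⁺)`, sibling chain), i.e. the gap to `B₃` is a factor `≈ p`, not `1 + 4/p`.
The counting method closes the `(2,1)` cells `p ≤ 7` (modulo the level-one budget value) and nothing beyond.

## Findings (index)
* `lieRankBeatsCubes_iff`, `design_three_iff` — the crux is the sibling's design predicate at `ε = 1`
  (`3 = 2 + 1`, `V^{(2+1)/3} = V`), so every `ε`-lemma of `Cruxes/LieRankDesigns/Disproof.lean` applies.
* `not_beatsCubes_levelZero`, `not_beatsCubes_rankZeroMatrices`, `not_beatsCubes_matOne` — the slices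
  `k = 0`, `m = 0`, `m = 1` are FALSE: every witness has `m ≥ 2`, `1 ≤ k` (`two_le_of_witness`).
* `beatsCubes_le_variant` — `≤` for `<` is trivially TRUE (singleton design): strictness is load-bearing, tight.
* `sum_psi_trace_mul`, `levelSet_eq_univ_of_le`, `rankSep_iff_tpp_of_le`, `budget_eq_full_of_le`,
  `topLevel_slice_iff` — LOAD-BEARING HYPOTHESIS `k < m`: at `k ≥ m` the test space is all of `ℂ^G`
  (Fourier inversion on `M_m(𝔽_p)`), separation is EXACTLY the triple product property and the budget is the
  FULL cube sum; the `k ≥ m` slice of the crux is the classical open problem (LANDING as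
  `Theorems/LieRankBeatsCubes/Negative/TopLevel.lean`).  So a refutation of the crux would in particular prove
  "no TPP triple of any `GL_m(𝔽_p)` beats `Σ_{Irr GL_m(𝔽_p)} d³`".
* `rank_le_one_iff_det_eq_zero`, `card_rankLE_two_one` — `N_1(GL_2) = #{M ∈ M_2(𝔽_p) : rk M ≤ 1} = p³+p²−p`.
* `volume_le_psi` — integer form of the graded Neumann cap `V ≤ ψ(N) := max_s (sN + s² − s³)`;
  `cube_cap_exact` / `volume_le_exact_dim` — the EXACT integer cap `V ≤ max_{m ≤ M, mM ≤ N} mM(1 + ⌊(N−mM)/M⌋)`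
  (e.g. `2904` at `N = 377` where the real relaxation gives `2937`).
* `finrank_levelSubmodule_two_one_le` — SHARPER WALL `dim F_1|_{GL_2(𝔽_p)} ≤ (p+1)(p²−1) − p = p³+p²−2p−1`
  (cell indicators over the `p+1` directions minus the `p` partition-of-unity relations; truth `p³+p²−3p−1`),
  with the dim-based Neumann counts `neumann_X_dim`, `neumann_Z_dim`.
* `not_beatsCubes_GL2_level1_{two,three,five,seven}_of_budget` — the cells `(m,k) = (2,1)`, `p ∈ {2,3,5,7}`,
  are DEAD MODULO the level-one budget value `B₃(p) = 1 + p³ + (p−2)(p+1)³ ≤ budget p 2 1 3`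
  (`9, 92, 774, 2904`): `V ≤ 9, 84, 721, 2904` respectively (`p = 7` is razor-thin: exact cap `= B₃`).  The
  budget inequality is representation theory of `GL_2(𝔽_p)` (`Irr ∩ F_1 = {1, St, π(θ,1)}`), not in the tree:
  the precise hypothesis `LevelOneBudgetLB p`.  The counting method reaches no further: for `p ≥ 11` the window
  `(B₃, cap]` is open (`p = 11`: `(16884, 21032]`).
* `not_rankSep_affPlus_torusTwo_uMinus` — the frontier triple `(Aff⁺, T₂, U⁻)` NAMED IN THE CRUX TEXT is not a
  rank-1 design (every odd `p`; `w`-conjugate to `(U⁻T₂, T₁, U⁺)`, `not_rankSep_affMinus_torusOne_uPlus`).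
* `not_rankSep_of_balanced` — the CIRCUIT CRITERION (general `m, k`): a weighting balanced against level `k`,
  supported in `X⁻¹YY⁻¹Z` and nonzero at a target, kills separation.
* `not_rankSep_of_ldu_rectangle`, `rankSep_translate`, `not_rankSep_of_ldu_rectangle_translate`,
  `not_rankSep_borelConfiguration` — FAMILY KILL for every odd `p`: if `X ⊇ gU⁻a`, `Z ⊇ gU⁺d` and
  `Y ⊇ g·{diag(a',d') : a', d' ∈ {1, c}}·b` (`c ≠ 1`), then `(X, Y, Z)` is NOT rank-1 separated — already
  `(U⁻, R_c, U⁺)` of volume `4p²` fails; in particular the Borel configuration `(U⁻, T, U⁺)` (TPP,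
  `borelConfiguration_tpp`; volume `p²(p−1)² = |G|·p/(p+1)`, `borelConfiguration_volume`; the prime-field
  frontier named in the crux text) is not a rank-1 design.  Mechanism: the alternating LDU functional
  `Λ_c(F) = Σ_{β,γ}[F(g₁₁) − F(g₁c) − F(g_c1) + F(g_cc)]` annihilates `F_1` (`Λ_fourierFn_eq_zero`) and is `1` on
  separators (`Λ_sep_eq_one`): `U⁻·R_c·U⁺` is a CIRCUIT of the level-one matroid through `1`.  (LANDED/LANDING as
  `Theorems/LieRankBeatsCubes/Negative/{BorelSubgroups (p77088 ACCEPTED), LDUFunctional, BorelConfiguration}.lean`.)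

## Why it resists / what a kill would need (for the provers)
See the `Analysis` docstring at the end: matroid (coloop) criterion for rank-1 separation, circuits of size
`4(p−1)` in `N(T)` and `4(p+1)` in `N(T_ns)`, the `V/p⁴` heuristic for TPP violations of Borel-type designs,
and the kit jobs (j010910 selftest, j010922/30/35 random maximal triples `p = 3,5,7`, j010934/46 structured
`p = 11, 13`, j010944 `p = 7`) whose results are folded in on delivery.
-/

set_option linter.dupNamespace false

noncomputable section

open scoped BigOperators
open Literature.RepresentationTheory.FiniteGroups

namespace Summit.MatrixMultiplication.MatrixMultiplication.Cruxes.LieRankBeatsCubes.Disproof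

open Summit.MatrixMultiplication.MatrixMultiplication.Theses.LevelGradedCohnUmans
open Summit.MatrixMultiplication.MatrixMultiplication.Cruxes.LieRankDesigns.Disproof

variable {p m : ℕ}

/-! ## The crux in the sibling's vocabulary; exponent `3 = 2 + 1` -/

/-- The crux, restated — by `Iff.rfl`, so nothing below drifts from the statement as filed. -/
theorem lieRankBeatsCubes_iff :
    LieRankBeatsCubes ↔ ∃ (p : ℕ) (_ : Fact p.Prime) (m k : ℕ) (X Y Z : Finset (GLm p m)),
      RankSep k X Y Z ∧ budget p m k 3 < volume X Y Z :=
  Iff.rfl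

/-- Exponent `3` is the sibling's exponent `2 + ε` at `ε = 1` (and `V^{(2+1)/3} = V`). -/
theorem design_three_iff [Fact p.Prime] {k : ℕ} {X Y Z : Finset (GLm p m)} :
    budget p m k 3 < volume X Y Z ↔ budget p m k (2 + 1) < volume X Y Z ^ (((2 : ℝ) + 1) / 3) := by
  rw [show ((2 : ℝ) + 1) / 3 = 1 by norm_num, Real.rpow_one, show (2 : ℝ) + 1 = 3 by norm_num]

/-! ## Degenerate cells are dead at exponent 3 -/

section Degenerate

variable [Fact p.Prime]

/-- **Level `k = 0` is dead**: constants separate only the trivial design, whose volume `1` does not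
exceed the budget `≥ 1`. -/
theorem not_beatsCubes_levelZero {X Y Z : Finset (GLm p m)} (h : RankSep 0 X Y Z) :
    ¬ budget p m 0 3 < volume X Y Z := by
  rw [design_three_iff]; exact not_design_levelZero one_pos h

/-- **`m = 0` is dead** (`GL_0` is trivial, `V ≤ 1 ≤` budget). -/
theorem not_beatsCubes_rankZeroMatrices {k : ℕ} (X Y Z : Finset (GLm p 0)) :
    ¬ budget p 0 k 3 < volume X Y Z := by
  intro hlt
  rw [design_three_iff] at hlt
  have := two_le_volume one_pos hlt
  have := volume_le_one_of_m_zero X Y Z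
  omega

/-- **`m = 1` is dead** (`GL_1(𝔽_p) = 𝔽_pˣ` abelian: for `k ≥ 1` the budget is the FULL one `= p − 1 ≥ V`,
for `k = 0` see above). -/
theorem not_beatsCubes_matOne {k : ℕ} {X Y Z : Finset (GLm p 1)} (h : RankSep k X Y Z) :
    ¬ budget p 1 k 3 < volume X Y Z := by
  rw [design_three_iff]; exact not_design_matOne one_pos le_rfl h

/-- Hence **every witness of the crux has `m ≥ 2` and `k ≥ 1`.** -/
theorem two_le_of_witness {k : ℕ} {X Y Z : Finset (GLm p m)} (h : RankSep k X Y Z)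
    (hlt : budget p m k 3 < volume X Y Z) : 2 ≤ m ∧ 1 ≤ k := by
  constructor
  · by_contra hm
    push Not at hm
    interval_cases m
    · exact not_beatsCubes_rankZeroMatrices X Y Z hlt
    · exact not_beatsCubes_matOne h hlt
  · by_contra hk
    push Not at hk
    interval_cases k
    exact not_beatsCubes_levelZero h hlt

end Degenerate

/-- **STRENGTHENINGS REFUTED (degenerate slices).**  The slices `k = 0`, `m = 0`, `m = 1` of
`LieRankBeatsCubes` are false. -/
theorem not_lieRankBeatsCubes_degenerate :
    ¬ (∃ (p : ℕ) (_ : Fact p.Prime) (m k : ℕ) (X Y Z : Finset (GLm p m)),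
        (m ≤ 1 ∨ k = 0) ∧ RankSep k X Y Z ∧ budget p m k 3 < volume X Y Z) := by
  rintro ⟨p, hp, m, k, X, Y, Z, hdeg, hsep, hlt⟩
  obtain ⟨hm, hk⟩ := two_le_of_witness hsep hlt
  omega

/-! ## Tightness: `≤` for `<` is trivially true -/

/-- **WEAKENING IS TRIVIAL.**  With `≤` in place of `<` the crux holds (singleton design at level `0`,
budget `= 1 = V`): the strict inequality is load-bearing and TIGHT at the trivial design. -/
theorem beatsCubes_le_variant :
    ∃ (p : ℕ) (_ : Fact p.Prime) (m k : ℕ) (X Y Z : Finset (GLm p m)),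
      RankSep k X Y Z ∧ budget p m k 3 ≤ volume X Y Z := by
  refine ⟨2, ⟨Nat.prime_two⟩, 1, 0, {1}, {1}, {1}, rankSep_singleton, ?_⟩
  rw [budget_levelZero]
  simp [volume]

/-! ## LOAD-BEARING: the rank restriction.  At `k ≥ m` the crux is Cohn–Umans' full-budget problem -/

section TopLevel

variable [Fact p.Prime]

/-- Additive characters turn finite sums into products. [folklore] -/
theorem addChar_map_sum_eq_prod {A M : Type*} [AddCommMonoid A] [CommMonoid M] {ι : Type*}
    (ψ : AddChar A M) (s : Finset ι) (x : ι → A) :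
    ψ (∑ i ∈ s, x i) = ∏ i ∈ s, ψ (x i) := by
  classical
  induction s using Finset.cons_induction with
  | empty => simp
  | cons a s ha ih => rw [Finset.sum_cons, Finset.prod_cons, AddChar.map_add_eq_mul, ih]

/-- **Orthogonality of the trace pairing on `M_m(𝔽_p)`**:
`Σ_{M ∈ M_m(𝔽_p)} ψ(tr(M D)) = p^{m²}·[D = 0]`. [folklore] -/
theorem sum_psi_trace_mul (D : Mat p m) :
    ∑ M : Mat p m, ZMod.stdAddChar (Matrix.trace (M * D)) =
      if D = 0 then ((p : ℂ) ^ (m * m)) else 0 := by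
  classical
  -- ψ(tr(M D)) = ∏_i ∏_j ψ(M i j * D j i)
  have hexp : ∀ M : Mat p m, ZMod.stdAddChar (Matrix.trace (M * D)) =
      ∏ i : Fin m, ∏ j : Fin m, ZMod.stdAddChar (M i j * D j i) := by
    intro M
    rw [Matrix.trace]
    simp only [Matrix.diag_apply, Matrix.mul_apply]
    rw [addChar_map_sum_eq_prod]
    refine Finset.prod_congr rfl fun i _ => ?_
    rw [addChar_map_sum_eq_prod]
  simp_rw [hexp]
  -- ∑_M ∏_i ∏_j f i j (M i j) = ∏_i ∏_j ∑_x f i j x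
  have hswap : (∑ M : Mat p m, ∏ i : Fin m, ∏ j : Fin m, ZMod.stdAddChar (M i j * D j i)) =
      ∏ i : Fin m, ∏ j : Fin m, ∑ x : ZMod p, ZMod.stdAddChar (x * D j i) := by
    calc (∑ M : Mat p m, ∏ i : Fin m, ∏ j : Fin m, ZMod.stdAddChar (M i j * D j i))
        = ∑ f : Fin m → Fin m → ZMod p, ∏ i : Fin m, ∏ j : Fin m, ZMod.stdAddChar (f i j * D j i) := by
          rw [← Equiv.sum_comp Matrix.of]
          rfl
      _ = ∏ i : Fin m, ∑ r : Fin m → ZMod p, ∏ j : Fin m, ZMod.stdAddChar (r j * D j i) :=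
          (Fintype.prod_sum (fun (i : Fin m) (r : Fin m → ZMod p) =>
            ∏ j : Fin m, ZMod.stdAddChar (r j * D j i))).symm
      _ = ∏ i : Fin m, ∏ j : Fin m, ∑ x : ZMod p, ZMod.stdAddChar (x * D j i) := by
          refine Finset.prod_congr rfl fun i _ => ?_
          exact (Fintype.prod_sum (fun (j : Fin m) (x : ZMod p) => ZMod.stdAddChar (x * D j i))).symm
  rw [hswap]
  have hinner : ∀ i j : Fin m, (∑ x : ZMod p, ZMod.stdAddChar (x * D j i)) =
      if D j i = 0 then (p : ℂ) else 0 := by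
    intro i j
    rw [AddChar.sum_mulShift (D j i) (ZMod.isPrimitive_stdAddChar p), ZMod.card]
    split_ifs <;> simp
  simp_rw [hinner]
  by_cases hD : D = 0
  · subst hD
    simp only [Matrix.zero_apply, if_true]
    rw [Finset.prod_const, Finset.prod_const, Finset.card_univ, Fintype.card_fin, ← pow_mul]
  · rw [if_neg hD]
    obtain ⟨j, i, hji⟩ : ∃ j i, D j i ≠ 0 := by
      by_contra hall
      push Not at hall
      exact hD (Matrix.ext fun j i => hall j i)
    exact Finset.prod_eq_zero (Finset.mem_univ i)
      (Finset.prod_eq_zero (Finset.mem_univ j) (by rw [if_neg hji]))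

/-- **Fourier inversion on `GL_m(𝔽_p)`: for `k ≥ m` EVERY function has level `k`**, i.e.
`levelSet p m k = univ` — the rank restriction is vacuous and the test space is all of `ℂ^G`
(so the graded budget is the FULL one). [folklore] -/
theorem levelSet_eq_univ_of_le {k : ℕ} (hmk : m ≤ k) : levelSet p m k = Set.univ := by
  classical
  refine Set.eq_univ_of_forall fun f => ?_
  have hp0 : ((p : ℂ) ^ (m * m)) ≠ 0 := pow_ne_zero _ (Nat.cast_ne_zero.mpr (NeZero.ne p))
  refine ⟨fun M => ((p : ℂ) ^ (m * m))⁻¹ *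
      ∑ h : GLm p m, f h * ZMod.stdAddChar (Matrix.trace (M * (-(h : Mat p m)))), ?_, fun g => ?_⟩
  · intro M hM
    exfalso
    have := Matrix.rank_le_width M
    omega
  · unfold fourierFn
    have hexp : ∀ M : Mat p m,
        (((p : ℂ) ^ (m * m))⁻¹ * ∑ h : GLm p m, f h * ZMod.stdAddChar (Matrix.trace (M * (-(h : Mat p m))))) *
          ZMod.stdAddChar (Matrix.trace (M * (g : Mat p m))) =
        ((p : ℂ) ^ (m * m))⁻¹ * ∑ h : GLm p m, f h *
          ZMod.stdAddChar (Matrix.trace (M * ((g : Mat p m) - (h : Mat p m)))) := by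
      intro M
      rw [mul_assoc, Finset.sum_mul]
      congr 1
      refine Finset.sum_congr rfl fun h _ => ?_
      rw [mul_assoc, ← AddChar.map_add_eq_mul, ← Matrix.trace_add, ← Matrix.mul_add, neg_add_eq_sub]
    simp_rw [hexp]
    rw [← Finset.mul_sum, Finset.sum_comm]
    simp_rw [← Finset.mul_sum]
    have hswap : ∀ h : GLm p m, (∑ M : Mat p m, ZMod.stdAddChar (Matrix.trace (M * ((g : Mat p m) - (h : Mat p m)))))
        = if ((g : Mat p m) - (h : Mat p m)) = 0 then ((p : ℂ) ^ (m * m)) else 0 := fun h =>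
      sum_psi_trace_mul _
    simp_rw [hswap, sub_eq_zero]
    have hval : ∀ h : GLm p m, f h * (if ((g : Mat p m) = (h : Mat p m)) then ((p : ℂ) ^ (m * m)) else 0) =
        if g = h then f g * (p : ℂ) ^ (m * m) else 0 := by
      intro h
      by_cases hgh : g = h
      · subst hgh; simp
      · rw [if_neg (fun e => hgh (Units.ext e)), if_neg hgh, mul_zero]
    simp_rw [hval]
    rw [Finset.sum_ite_eq, if_pos (Finset.mem_univ _), ← mul_assoc, mul_comm (((p : ℂ) ^ (m * m))⁻¹),
      mul_assoc, inv_mul_cancel₀ hp0, mul_one]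

/-- At the top levels the graded budget is the FULL character-degree sum `Σ_{χ ∈ Irr} χ(1)^s`. -/
theorem budget_eq_full_of_le {k : ℕ} (hmk : m ≤ k) (s : ℝ) :
    budget p m k s = ∑ᶠ χ ∈ irrChars (GLm p m), (χ 1).re ^ s := by
  unfold budget
  rw [levelSet_eq_univ_of_le hmk, Set.inter_univ]

omit [Fact (Nat.Prime p)] in
/-- Under TPP, an off-target quadruple product never hits the target value. [folklore] -/
theorem quad_eq_target_iff {X Y Z : Finset (GLm p m)}
    (htpp : Literature.Combinatorics.Additive.TripleProductProperty X Y Z)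
    {x₀ x y y' z z₀ : GLm p m} (hx₀ : x₀ ∈ X) (hx : x ∈ X) (hy : y ∈ Y) (hy' : y' ∈ Y) (hz : z ∈ Z)
    (hz₀ : z₀ ∈ Z) : x⁻¹ * y * y'⁻¹ * z = x₀⁻¹ * z₀ ↔ (x = x₀ ∧ y = y' ∧ z = z₀) := by
  constructor
  · intro h
    have h1 : x₀ * x⁻¹ * (y * y'⁻¹) * (z * z₀⁻¹) = 1 := by
      have : x₀ * (x⁻¹ * y * y'⁻¹ * z) * z₀⁻¹ = x₀ * (x₀⁻¹ * z₀) * z₀⁻¹ := by rw [h]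
      calc x₀ * x⁻¹ * (y * y'⁻¹) * (z * z₀⁻¹) = x₀ * (x⁻¹ * y * y'⁻¹ * z) * z₀⁻¹ := by group
        _ = x₀ * (x₀⁻¹ * z₀) * z₀⁻¹ := this
        _ = 1 := by group
    obtain ⟨h2, h3, h4⟩ := htpp x₀ hx₀ x hx y hy y' hy' z hz z₀ hz₀ h1
    exact ⟨h2.symm, h3, h4⟩
  · rintro ⟨rfl, rfl, rfl⟩
    group

/-- **At the top levels separation IS the triple product property.**  For `k ≥ m`,
`RankSep k X Y Z ↔ TPP(X, Y, Z)`: `⇒` is the sibling's `tpp_of_rankSep`; `⇐` takes the delta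
function of the target, which has level `k` by `levelSet_eq_univ_of_le`. -/
theorem rankSep_iff_tpp_of_le {k : ℕ} (hmk : m ≤ k) {X Y Z : Finset (GLm p m)} :
    RankSep k X Y Z ↔ Literature.Combinatorics.Additive.TripleProductProperty X Y Z := by
  classical
  refine ⟨tpp_of_rankSep, fun htpp => ?_⟩
  intro x₀ hx₀ z₀ hz₀
  have hmem : (fun g : GLm p m => if g = x₀⁻¹ * z₀ then (1 : ℂ) else 0) ∈ levelSet p m k := by
    rw [levelSet_eq_univ_of_le hmk]; trivial
  obtain ⟨c, hc, hfc⟩ := hmem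
  refine ⟨c, hc, fun x hx y hy y' hy' z hz => ?_⟩
  rw [← hfc]
  dsimp only
  by_cases h : x = x₀ ∧ y = y' ∧ z = z₀
  · rw [if_pos h, if_pos ((quad_eq_target_iff htpp hx₀ hx hy hy' hz hz₀).mpr h)]
  · rw [if_neg h, if_neg (fun e => h ((quad_eq_target_iff htpp hx₀ hx hy hy' hz hz₀).mp e))]

/-- **THE TOP-LEVEL SLICE OF THE CRUX IS COHN–UMANS' FULL-BUDGET PROBLEM.**  The cells `k ≥ m` of
`LieRankBeatsCubes` say exactly: some `GL_m(𝔽_p)` contains a TPP triple beating the FULL sum of the cubes of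
its character degrees — "beating the sum of the cubes" (CKSU 2005, §2) inside a general linear group over a
prime field, an OPEN question (no construction known; the quasirandom cap `|G|^{3/2}/√(p−1) + |G|` of
`BCGPU2023_thm32` exceeds `Σ d³ ≈ p^{(3m²−m)/2}` by a factor `≈ √p`, so no catalogued barrier excludes it).
Consequently an unconditional `¬ LieRankBeatsCubes` would contain a new theorem of that strength. -/
theorem topLevel_slice_iff :
    (∃ (p : ℕ) (_ : Fact p.Prime) (m k : ℕ) (X Y Z : Finset (GLm p m)),
        m ≤ k ∧ RankSep k X Y Z ∧ budget p m k 3 < volume X Y Z) ↔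
    (∃ (p : ℕ) (_ : Fact p.Prime) (m : ℕ) (X Y Z : Finset (GLm p m)),
        Literature.Combinatorics.Additive.TripleProductProperty X Y Z ∧
        (∑ᶠ χ ∈ irrChars (GLm p m), (χ 1).re ^ (3 : ℝ)) < volume X Y Z) := by
  constructor
  · rintro ⟨p, hp, m, k, X, Y, Z, hmk, hsep, hlt⟩
    exact ⟨p, hp, m, X, Y, Z, (rankSep_iff_tpp_of_le hmk).mp hsep, by rwa [← budget_eq_full_of_le hmk]⟩
  · rintro ⟨p, hp, m, X, Y, Z, htpp, hlt⟩
    exact ⟨p, hp, m, m, X, Y, Z, le_rfl, (rankSep_iff_tpp_of_le le_rfl).mpr htpp,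
      by rwa [budget_eq_full_of_le le_rfl]⟩

end TopLevel

/-! ## `GL_2` level one: `N_1 = #{M ∈ M_2(𝔽_p) : rk M ≤ 1} = p³ + p² − p` -/

section LevelOneCount

variable [Fact p.Prime]

/-- A `2 × 2` matrix over a field has rank `≤ 1` iff it is singular. [folklore] -/
theorem rank_le_one_iff_det_eq_zero (M : Mat p 2) : M.rank ≤ 1 ↔ M.det = 0 := by
  constructor
  · intro h
    by_contra hdet
    have hu : IsUnit M := (Matrix.isUnit_iff_isUnit_det M).mpr (isUnit_iff_ne_zero.mpr hdet)
    have := Matrix.rank_of_isUnit M hu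
    rw [Fintype.card_fin] at this
    omega
  · intro h
    have := Literature.Computability.AlgebraicComplexity.Matrix.rank_lt_card_of_det_eq_zero h
    rw [Fintype.card_fin] at this
    omega

/-- `GL_2(𝔽_p)` is the set of `2 × 2` matrices with nonzero determinant. [folklore] -/
def glEquivDetNeZero : GLm p 2 ≃ {M : Mat p 2 // ¬ M.det = 0} where
  toFun g := ⟨(g : Mat p 2), by
    rw [← Matrix.GeneralLinearGroup.val_det_apply]; exact Units.ne_zero _⟩
  invFun M := Matrix.GeneralLinearGroup.mkOfDetNeZero M.1 M.2
  left_inv g := by apply Units.ext; rfl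
  right_inv M := by rfl

/-- `|GL_2(𝔽_p)| = (p² − 1)(p² − p)`. [folklore] -/
theorem card_GLm_two : Fintype.card (GLm p 2) = (p ^ 2 - 1) * (p ^ 2 - p) := by
  rw [← Nat.card_eq_fintype_card]
  have h := @Matrix.card_GL_field (ZMod p) _ _ 2
  rw [ZMod.card] at h
  rw [show GLm p 2 = GL (Fin 2) (ZMod p) from rfl, h, Fin.prod_univ_two]
  simp

/-- **`N_1(GL_2(𝔽_p)) = p³ + p² − p`**: the number of `2 × 2` matrices of rank `≤ 1` over `𝔽_p`
(the zero matrix and the `(p²−1)²/(p−1)` outer products). [folklore] -/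
theorem card_rankLE_two_one : Fintype.card (RankLE p 2 1) = p ^ 3 + p ^ 2 - p := by
  classical
  have h1 : Fintype.card (RankLE p 2 1) = Fintype.card {M : Mat p 2 // M.det = 0} :=
    Fintype.card_congr (Equiv.subtypeEquivRight fun M => rank_le_one_iff_det_eq_zero M)
  have h2 : Fintype.card {M : Mat p 2 // ¬ M.det = 0} =
      Fintype.card (Mat p 2) - Fintype.card {M : Mat p 2 // M.det = 0} :=
    Fintype.card_subtype_compl _
  have h3 : Fintype.card {M : Mat p 2 // ¬ M.det = 0} = (p ^ 2 - 1) * (p ^ 2 - p) := by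
    rw [← card_GLm_two]; exact (Fintype.card_congr glEquivDetNeZero).symm
  have h4 : Fintype.card (Mat p 2) = p ^ 4 := by
    rw [Fintype.card_congr (Matrix.of (m := Fin 2) (n := Fin 2) (α := ZMod p)).symm]
    simp only [Fintype.card_pi, Finset.prod_const, Finset.card_univ, Fintype.card_fin, ZMod.card]
    ring
  have hle : Fintype.card {M : Mat p 2 // M.det = 0} ≤ Fintype.card (Mat p 2) :=
    Fintype.card_subtype_le _
  rw [h1]
  rw [h3, h4] at h2
  have hp1 : 1 ≤ p := (Fact.out : p.Prime).one_le
  have hp2 : p ≤ p ^ 2 := by nlinarith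
  have hp3 : 1 ≤ p ^ 2 := by nlinarith
  have hp4 : p ≤ p ^ 3 + p ^ 2 := by nlinarith
  rw [h4] at hle
  zify [hp2, hp3, hp4, hle] at h2 ⊢
  linear_combination h2

end LevelOneCount

/-! ## The exact integer Neumann cap `V ≤ ψ(N) = max_s (sN + s² − s³)` -/

section Psi

/-- Arithmetic core: from the two packing counts `ac + a(b−1) ≤ N`, `ac + (b−1)c ≤ N` one gets
`abc ≤ mN + m² − m³` with `m = min(a,c)`, hence `abc ≤ B` as soon as `sN + s² ≤ B + s³` for all `s`. -/
theorem cube_cap (a b c N B : ℕ) (h1 : a * c + a * (b - 1) ≤ N) (h2 : a * c + (b - 1) * c ≤ N)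
    (hB : ∀ s : ℕ, s * N + s ^ 2 ≤ B + s ^ 3) : a * b * c ≤ B := by
  rcases Nat.eq_zero_or_pos b with rfl | hb
  · simp
  wlog hac : a ≤ c generalizing a c
  · have := this c a (by linarith) (by linarith) (le_of_not_ge hac)
    linarith [this, show a * b * c = c * b * a by ring]
  -- now m = a
  rcases Nat.eq_zero_or_pos a with rfl | ha
  · simp
  obtain ⟨b', rfl⟩ : ∃ b', b = b' + 1 := ⟨b - 1, by omega⟩
  simp only [Nat.add_sub_cancel] at h1 h2
  have key : a * (b' + 1) * c + a ^ 3 ≤ a * N + a ^ 2 := by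
    -- a·h2 : a²c + a b' c ≤ aN ; and a (a - 1) (c - a) ≥ 0
    have hh : a * (a * c + b' * c) ≤ a * N := Nat.mul_le_mul_left a h2
    have ha1 : (0 : ℤ) ≤ (a : ℤ) - 1 := by
      have : (1 : ℤ) ≤ a := by exact_mod_cast ha
      linarith
    have hca : (0 : ℤ) ≤ (c : ℤ) - a := by
      have : (a : ℤ) ≤ c := by exact_mod_cast hac
      linarith
    have hint : (0 : ℤ) ≤ (a : ℤ) * ((a : ℤ) - 1) * ((c : ℤ) - a) :=
      mul_nonneg (mul_nonneg (Int.natCast_nonneg a) ha1) hca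
    zify at hh ⊢
    nlinarith [hh, hint]
  have := hB a
  omega

/-- Beyond `s = N` the condition `sN + s² ≤ B + s³` is automatic, so it suffices to check `s ≤ N`
(a `decide`-able finite conjunction for concrete `N`, `B`). -/
theorem psi_hyp_of_bounded (N B : ℕ) (h : ∀ s ≤ N, s * N + s ^ 2 ≤ B + s ^ 3) :
    ∀ s : ℕ, s * N + s ^ 2 ≤ B + s ^ 3 := by
  intro s
  rcases Nat.lt_or_ge N s with hs | hs
  swap
  · exact h s hs
  · rcases Nat.lt_or_ge s 2 with h2 | h2
    · interval_cases s
      · simp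
      · have hN : N = 0 := by omega
        subst hN
        simp
    · have h1 : s * N + s ^ 2 ≤ s * s + s ^ 2 := by nlinarith
      have h3 : s * s + s ^ 2 ≤ s ^ 3 := by nlinarith
      omega

variable [Fact p.Prime] {k : ℕ} {X Y Z : Finset (GLm p m)}

/-- **Exact graded Neumann cap.**  For an `F_k`-separated triple and `N = N_k = #{rk ≤ k}`:
`|X||Y||Z| ≤ B` whenever `sN + s² ≤ B + s³` for every `s` — i.e. `V ≤ ψ(N) := max_s (sN + s² − s³)`
(`≈ 0.385 N^{3/2}`; the sibling's `volume_le_cubicBudget` is the AM–GM relaxation of this). -/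
theorem volume_le_psi (hsep : RankSep k X Y Z) (B : ℕ)
    (hB : ∀ s : ℕ, s * Fintype.card (RankLE p m k) + s ^ 2 ≤ B + s ^ 3) :
    X.card * Y.card * Z.card ≤ B := by
  obtain hX | ⟨x₁, hx₁⟩ := X.eq_empty_or_nonempty
  · simp [hX]
  obtain hY | ⟨y₁, hy₁⟩ := Y.eq_empty_or_nonempty
  · simp [hY]
  obtain hZ | ⟨z₁, hz₁⟩ := Z.eq_empty_or_nonempty
  · simp [hZ]
  exact cube_cap _ _ _ _ B (neumann_X hsep hy₁ hz₁) (neumann_Z hsep hx₁ hy₁) hB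

end Psi

/-! ## Cells `(m, k, p) = (2, 1, 3)` and `(2, 1, 5)` are dead MODULO the level-one budget -/

section SmallCells

/-- **The level-one budget lower bound** `B₃(p) = 1 + p³ + (p − 2)(p + 1)³ ≤ Σ_{χ ∈ Irr(GL_2(𝔽_p)) ∩ F_1} χ(1)³`
(representation theory of `GL_2(𝔽_p)`: the constituents of the permutation module `ℂ[𝔽_p² ∖ 0]` are
`1`, `St` (degree `p`) and the `p − 2` principal series `π(θ, 1)`, `θ ≠ 1` (degree `p + 1`), all in `F_1`;
Piatetski-Shapiro, *Complex representations of GL(2, K)*, §§7–9).  NOT in the tree; the precise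
hypothesis under which the small cells below are closed (a construction item for a prover; the sibling
chain's card `fixed-rank-universality-gl2-level-one` needs the matching upper bound `levelOne_budget_GL2`).
[cite: PiatetskiShapiro1983, §9] -/
def LevelOneBudgetLB (p : ℕ) [Fact p.Prime] : Prop :=
  (1 + (p : ℝ) ^ 3 + ((p : ℝ) - 2) * ((p : ℝ) + 1) ^ 3) ≤ budget p 2 1 3

/-- **Cell `GL_2(𝔽_3)`, level 1, is dead modulo the budget**: `N_1 = 33`, `ψ(33) = 84 < 92 = B₃(3)`. -/
theorem not_beatsCubes_GL2_level1_three_of_budget [Fact (3 : ℕ).Prime] (hB : LevelOneBudgetLB 3)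
    {X Y Z : Finset (GLm 3 2)} (hsep : RankSep 1 X Y Z) : ¬ budget 3 2 1 3 < volume X Y Z := by
  intro hlt
  have hN : Fintype.card (RankLE 3 2 1) = 33 := by rw [card_rankLE_two_one]; norm_num
  have hV : X.card * Y.card * Z.card ≤ 84 :=
    volume_le_psi hsep 84 (by rw [hN]; exact psi_hyp_of_bounded 33 84 (by decide))
  unfold LevelOneBudgetLB at hB
  have hV' : volume X Y Z ≤ 84 := by unfold volume; exact_mod_cast hV
  norm_num at hB
  linarith

/-- **Cell `GL_2(𝔽_5)`, level 1, is dead modulo the budget**: `N_1 = 145`, `ψ(145) = 721 < 774 = B₃(5)`. -/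
theorem not_beatsCubes_GL2_level1_five_of_budget [Fact (5 : ℕ).Prime] (hB : LevelOneBudgetLB 5)
    {X Y Z : Finset (GLm 5 2)} (hsep : RankSep 1 X Y Z) : ¬ budget 5 2 1 3 < volume X Y Z := by
  intro hlt
  have hN : Fintype.card (RankLE 5 2 1) = 145 := by rw [card_rankLE_two_one]; norm_num
  have hV : X.card * Y.card * Z.card ≤ 721 :=
    volume_le_psi hsep 721 (by rw [hN]; exact psi_hyp_of_bounded 145 721 (by decide))
  unfold LevelOneBudgetLB at hB
  have hV' : volume X Y Z ≤ 721 := by unfold volume; exact_mod_cast hV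
  norm_num at hB
  linarith

end SmallCells

/-! ## FAMILY KILL: the Borel configuration `(U⁻, T, U⁺)` of `GL_2(𝔽_p)` is TPP but NOT rank-1 separated -/

section BorelConfiguration

variable [Fact p.Prime]

/-- Lower unitriangular `[1 0; γ 1]`. -/
def uMinus (γ : ZMod p) : GLm p 2 :=
  Matrix.GeneralLinearGroup.mkOfDetNeZero !![1, 0; γ, 1] (by simp [Matrix.det_fin_two])

/-- Upper unitriangular `[1 β; 0 1]`. -/
def uPlus (β : ZMod p) : GLm p 2 :=
  Matrix.GeneralLinearGroup.mkOfDetNeZero !![1, β; 0, 1] (by simp [Matrix.det_fin_two])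

/-- Diagonal torus element `diag(a, d)`. -/
def torU (a d : (ZMod p)ˣ) : GLm p 2 :=
  Matrix.GeneralLinearGroup.mkOfDetNeZero !![(a : ZMod p), 0; 0, (d : ZMod p)]
    (by simp [Matrix.det_fin_two, a.ne_zero, d.ne_zero])

/-- Underlying matrix of `uMinus`. -/
@[simp] theorem coe_uMinus (γ : ZMod p) : ((uMinus γ : GLm p 2) : Mat p 2) = !![1, 0; γ, 1] := rfl
/-- Underlying matrix of `uPlus`. -/
@[simp] theorem coe_uPlus (β : ZMod p) : ((uPlus β : GLm p 2) : Mat p 2) = !![1, β; 0, 1] := rfl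
/-- Underlying matrix of `torU`. -/
@[simp] theorem coe_torU (a d : (ZMod p)ˣ) :
    ((torU a d : GLm p 2) : Mat p 2) = !![(a : ZMod p), 0; 0, (d : ZMod p)] := rfl

/-- `U⁻ ⊂ GL_2(𝔽_p)` as a finite set. -/
def Uminus (p : ℕ) [Fact p.Prime] : Finset (GLm p 2) := Finset.univ.image uMinus

/-- `U⁺ ⊂ GL_2(𝔽_p)` as a finite set. -/
def Uplus (p : ℕ) [Fact p.Prime] : Finset (GLm p 2) := Finset.univ.image uPlus

/-- The diagonal torus `T ⊂ GL_2(𝔽_p)` as a finite set. -/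
def Torus (p : ℕ) [Fact p.Prime] : Finset (GLm p 2) :=
  (Finset.univ : Finset ((ZMod p)ˣ × (ZMod p)ˣ)).image fun ad => torU ad.1 ad.2

/-- `γ ↦ [1 0; γ 1]` is injective. -/
theorem uMinus_injective : Function.Injective (uMinus (p := p)) := by
  intro γ γ' h
  have := congrArg (fun g : GLm p 2 => (g : Mat p 2) 1 0) h
  simpa using this

/-- `β ↦ [1 β; 0 1]` is injective. -/
theorem uPlus_injective : Function.Injective (uPlus (p := p)) := by
  intro β β' h
  have := congrArg (fun g : GLm p 2 => (g : Mat p 2) 0 1) h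
  simpa using this

/-- `(a, d) ↦ diag(a, d)` is injective. -/
theorem torU_injective : Function.Injective (fun ad : (ZMod p)ˣ × (ZMod p)ˣ => torU ad.1 ad.2) := by
  rintro ⟨a, d⟩ ⟨a', d'⟩ h
  have h1 := congrArg (fun g : GLm p 2 => (g : Mat p 2) 0 0) h
  have h2 := congrArg (fun g : GLm p 2 => (g : Mat p 2) 1 1) h
  simp only [coe_torU, Matrix.of_apply, Matrix.cons_val', Matrix.cons_val_zero, Matrix.cons_val_one,
    Matrix.cons_val_fin_one] at h1 h2
  exact Prod.ext (Units.ext h1) (Units.ext h2)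

/-- `|U⁻| = p`. -/
theorem card_Uminus : (Uminus p).card = p := by
  rw [Uminus, Finset.card_image_of_injective _ uMinus_injective, Finset.card_univ, ZMod.card]

/-- `|U⁺| = p`. -/
theorem card_Uplus : (Uplus p).card = p := by
  rw [Uplus, Finset.card_image_of_injective _ uPlus_injective, Finset.card_univ, ZMod.card]

/-- `|T| = (p − 1)²`. -/
theorem card_Torus : (Torus p).card = (p - 1) ^ 2 := by
  rw [Torus, Finset.card_image_of_injective _ torU_injective, Finset.card_univ, Fintype.card_prod,
    ZMod.card_units_eq_totient, Nat.totient_prime (Fact.out), sq]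

/-- `U⁻` is a subgroup: `(uMinus (−γ))⁻¹ = uMinus γ`. -/
theorem uMinus_neg_inv (γ : ZMod p) : (uMinus (-γ))⁻¹ = uMinus γ := by
  rw [inv_eq_iff_eq_inv, eq_comm, inv_eq_iff_mul_eq_one]
  apply Units.ext
  simp [Matrix.one_fin_two]

/-- `diag(1, 1) = 1`. -/
theorem torU_one : torU (1 : (ZMod p)ˣ) 1 = 1 := by
  apply Units.ext
  simp [Matrix.one_fin_two]

/-- The LDU product `[1 0; γ 1]·diag(a, d)·[1 β; 0 1] = [a, aβ; γa, γaβ + d]`. -/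
theorem coe_ldu (γ : ZMod p) (a d : (ZMod p)ˣ) (β : ZMod p) :
    ((uMinus γ * torU a d * uPlus β : GLm p 2) : Mat p 2) =
      !![(a : ZMod p), a * β; γ * a, γ * a * β + d] := by
  simp

/-- The quadruple product of the separation clause for `x = uMinus (−γ)`, `y = torU a d`, `y' = 1`,
`z = uPlus β` is the LDU product. -/
theorem quad_ldu (γ : ZMod p) (a d : (ZMod p)ˣ) (β : ZMod p) :
    (uMinus (-γ))⁻¹ * torU a d * (torU (1 : (ZMod p)ˣ) 1)⁻¹ * uPlus β = uMinus γ * torU a d * uPlus β := by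
  rw [uMinus_neg_inv, torU_one, inv_one, mul_one]

omit [Fact (Nat.Prime p)] in
/-- Evaluation at `g`, as a linear form on `ℂ^{GL_2(𝔽_p)}`. -/
def ev (g : GLm p 2) : (GLm p 2 → ℂ) →ₗ[ℂ] ℂ := LinearMap.proj (R := ℂ) (φ := fun _ : GLm p 2 => ℂ) g

omit [Fact (Nat.Prime p)] in
/-- `ev g F = F g`. -/
@[simp] theorem ev_apply (g : GLm p 2) (F : GLm p 2 → ℂ) : ev g F = F g := rfl

/-- The alternating LDU functional (a linear form on `ℂ^{GL_2(𝔽_p)}`):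
`Λ_c(F) = Σ_{β,γ} [F(g₁₁) − F(g₁c) − F(g_c1) + F(g_cc)]`, `g_{ad} = [1 0; γ 1]·diag(a,d)·[1 β; 0 1]`. -/
def Λ (c : (ZMod p)ˣ) : (GLm p 2 → ℂ) →ₗ[ℂ] ℂ :=
  ∑ β : ZMod p, ∑ γ : ZMod p,
    (ev (uMinus γ * torU 1 1 * uPlus β) - ev (uMinus γ * torU 1 c * uPlus β)
      - ev (uMinus γ * torU c 1 * uPlus β) + ev (uMinus γ * torU c c * uPlus β))

/-- `Λ_c` evaluated: the alternating double sum over the four LDU blocks. -/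
theorem Λ_apply (c : (ZMod p)ˣ) (F : GLm p 2 → ℂ) :
    Λ c F = ∑ β : ZMod p, ∑ γ : ZMod p,
      (F (uMinus γ * torU 1 1 * uPlus β) - F (uMinus γ * torU 1 c * uPlus β)
        - F (uMinus γ * torU c 1 * uPlus β) + F (uMinus γ * torU c c * uPlus β)) := by
  simp only [Λ, LinearMap.coe_sum, Finset.sum_apply, LinearMap.sub_apply, LinearMap.add_apply, ev_apply]

/-- A Fourier function is the linear combination `Σ_M c_M • ψ(tr(M ·))`. -/
theorem fourierFn_eq_sum_smul (c' : Mat p 2 → ℂ) :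
    (fourierFn c' : GLm p 2 → ℂ) =
      ∑ M : Mat p 2, c' M • fun g : GLm p 2 => (ZMod.stdAddChar (Matrix.trace (M * (g : Mat p 2))) : ℂ) := by
  funext g
  simp [fourierFn, Finset.sum_apply]

/-- The two coordinates of `g·u` for the LDU product `g = [a, aβ; γa, γaβ + d]` and `u = (u₀, u₁)`. -/
theorem ldu_mulVec (γ : ZMod p) (a d : (ZMod p)ˣ) (β u₀ u₁ : ZMod p) :
    ((uMinus γ * torU a d * uPlus β : GLm p 2) : Mat p 2) 0 0 * u₀ +
        ((uMinus γ * torU a d * uPlus β : GLm p 2) : Mat p 2) 0 1 * u₁ = a * (u₀ + β * u₁) ∧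
    ((uMinus γ * torU a d * uPlus β : GLm p 2) : Mat p 2) 1 0 * u₀ +
        ((uMinus γ * torU a d * uPlus β : GLm p 2) : Mat p 2) 1 1 * u₁ =
      γ * (a * (u₀ + β * u₁)) + d * u₁ := by
  rw [coe_ldu]
  simp only [Matrix.of_apply, Matrix.cons_val', Matrix.cons_val_zero, Matrix.cons_val_one,
    Matrix.cons_val_fin_one]
  constructor <;> ring

/-- The `(a, d)`-block sum of a function of `g·u`:
`S(a,d) = Σ_{β,γ} Φ(a(u₀ + βu₁), γa(u₀ + βu₁) + d u₁)`. -/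
def blockSum (Φ : ZMod p → ZMod p → ℂ) (u₀ u₁ : ZMod p) (a d : (ZMod p)ˣ) : ℂ :=
  ∑ β : ZMod p, ∑ γ : ZMod p, Φ (a * (u₀ + β * u₁)) (γ * (a * (u₀ + β * u₁)) + d * u₁)

/-- **Fiber computation.**  For `u₁ ≠ 0` the block sum splits as `S(a, d) = K(d) + A(a)` with
`K(d) = p·Φ(0, d u₁)` (the line `u₀ + βu₁ = 0`) and `A(a) = Σ_{s ≠ 0} Σ_t Φ(a s, t)` (all other lines,
on each of which `γ ↦ γ a s + d u₁` is a bijection). -/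
theorem blockSum_eq (Φ : ZMod p → ZMod p → ℂ) (u₀ : ZMod p) {u₁ : ZMod p} (hu₁ : u₁ ≠ 0)
    (a d : (ZMod p)ˣ) :
    blockSum Φ u₀ u₁ a d =
      (∑ _γ : ZMod p, Φ 0 (d * u₁)) +
        ∑ s ∈ (Finset.univ : Finset (ZMod p)).erase 0, ∑ t : ZMod p, Φ (a * s) t := by
  classical
  unfold blockSum
  -- reindex β ↦ s = u₀ + β u₁
  set F : ZMod p → ℂ := fun s => ∑ γ : ZMod p, Φ (a * s) (γ * (a * s) + d * u₁) with hF
  have h1 : (∑ β : ZMod p, ∑ γ : ZMod p, Φ (a * (u₀ + β * u₁)) (γ * (a * (u₀ + β * u₁)) + d * u₁)) =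
      ∑ s : ZMod p, F s := by
    let e : ZMod p ≃ ZMod p := (Equiv.mulRight₀ u₁ hu₁).trans (Equiv.addLeft u₀)
    exact Equiv.sum_comp e F
  rw [h1, ← Finset.add_sum_erase _ _ (Finset.mem_univ (0 : ZMod p))]
  congr 1
  · simp [hF]
  · refine Finset.sum_congr rfl fun s hs => ?_
    have hs0 : s ≠ 0 := Finset.ne_of_mem_erase hs
    simp only [hF]
    let e : ZMod p ≃ ZMod p := (Equiv.mulRight₀ (a * s) (mul_ne_zero a.ne_zero hs0)).trans
      (Equiv.addRight (d * u₁))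
    exact Equiv.sum_comp e (Φ (a * s))

/-- **FIBER LEMMA.**  The alternating functional kills every function of a single matrix–vector product
`g·u` — i.e. every generator of the level-one test space: for all `u = (u₀, u₁)` and `Φ`,
`Λ_c (g ↦ Φ(g·u)) = 0`. -/
theorem Λ_apply_mulVec (c : (ZMod p)ˣ) (Φ : ZMod p → ZMod p → ℂ) (u₀ u₁ : ZMod p) :
    Λ c (fun g => Φ ((g : Mat p 2) 0 0 * u₀ + (g : Mat p 2) 0 1 * u₁)
      ((g : Mat p 2) 1 0 * u₀ + (g : Mat p 2) 1 1 * u₁)) = 0 := by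
  classical
  rw [Λ_apply]
  have hrw : ∀ (a d : (ZMod p)ˣ) (β γ : ZMod p),
      Φ (((uMinus γ * torU a d * uPlus β : GLm p 2) : Mat p 2) 0 0 * u₀ +
          ((uMinus γ * torU a d * uPlus β : GLm p 2) : Mat p 2) 0 1 * u₁)
        (((uMinus γ * torU a d * uPlus β : GLm p 2) : Mat p 2) 1 0 * u₀ +
          ((uMinus γ * torU a d * uPlus β : GLm p 2) : Mat p 2) 1 1 * u₁) =
      Φ (a * (u₀ + β * u₁)) (γ * (a * (u₀ + β * u₁)) + d * u₁) := by
    intro a d β γ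
    obtain ⟨h1, h2⟩ := ldu_mulVec γ a d β u₀ u₁
    rw [h1, h2]
  simp only [hrw]
  rw [show (∑ β : ZMod p, ∑ γ : ZMod p,
      (Φ (((1 : (ZMod p)ˣ) : ZMod p) * (u₀ + β * u₁)) (γ * (((1 : (ZMod p)ˣ) : ZMod p) * (u₀ + β * u₁)) + ((1 : (ZMod p)ˣ) : ZMod p) * u₁)
        - Φ (((1 : (ZMod p)ˣ) : ZMod p) * (u₀ + β * u₁)) (γ * (((1 : (ZMod p)ˣ) : ZMod p) * (u₀ + β * u₁)) + (c : ZMod p) * u₁)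
        - Φ ((c : ZMod p) * (u₀ + β * u₁)) (γ * ((c : ZMod p) * (u₀ + β * u₁)) + ((1 : (ZMod p)ˣ) : ZMod p) * u₁)
        + Φ ((c : ZMod p) * (u₀ + β * u₁)) (γ * ((c : ZMod p) * (u₀ + β * u₁)) + (c : ZMod p) * u₁))) =
      blockSum Φ u₀ u₁ 1 1 - blockSum Φ u₀ u₁ 1 c - blockSum Φ u₀ u₁ c 1 + blockSum Φ u₀ u₁ c c by
    simp only [blockSum, ← Finset.sum_sub_distrib, ← Finset.sum_add_distrib]]
  by_cases hu₁ : u₁ = 0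
  · subst hu₁
    simp [blockSum]
  · rw [blockSum_eq Φ u₀ hu₁, blockSum_eq Φ u₀ hu₁, blockSum_eq Φ u₀ hu₁, blockSum_eq Φ u₀ hu₁]
    ring

/-- A matrix of rank `≤ 1` over a field is an outer product `u vᵀ` (converse of Mathlib's
`Matrix.rank_vecMulVec_le`; same proof as the tree's
`Literature.Computability.AlgebraicComplexity.exists_vecMulVec_of_rank_le_one`, copied to keep the
import closure light). [folklore] -/
theorem exists_vecMulVec_of_rank_le_one {K : Type*} [Field K] {ι κ : Type*} [Fintype κ] [DecidableEq κ]
    (M : Matrix ι κ K) (h : M.rank ≤ 1) : ∃ (u : ι → K) (v : κ → K), M = Matrix.vecMulVec u v := by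
  obtain ⟨w, hw⟩ := finrank_le_one_iff.mp h
  have hcol : ∀ j, ∃ a : K, ∀ i, a * (w : ι → K) i = M i j := fun j => by
    have hj : M.col j ∈ LinearMap.range M.mulVecLin :=
      ⟨Pi.single j 1, by rw [Matrix.mulVecLin_apply, Matrix.mulVec_single_one]⟩
    obtain ⟨a, ha⟩ := hw ⟨M.col j, hj⟩
    refine ⟨a, fun i => ?_⟩
    have := congrArg (fun x : LinearMap.range M.mulVecLin => (x : ι → K) i) ha
    simpa using this
  choose a ha using hcol
  exact ⟨w, a, Matrix.ext fun i j => by rw [Matrix.vecMulVec_apply, ← ha j i, mul_comm]⟩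

/-- Trace pairing with an outer product is a function of `g·u`:
`tr(u vᵀ · g) = v₀ (g u)₀ + v₁ (g u)₁`. [folklore] -/
theorem trace_vecMulVec_mul (u v : Fin 2 → ZMod p) (g : Mat p 2) :
    Matrix.trace (Matrix.vecMulVec u v * g) =
      v 0 * (g 0 0 * u 0 + g 0 1 * u 1) + v 1 * (g 1 0 * u 0 + g 1 1 * u 1) := by
  rw [Matrix.trace_fin_two]
  simp only [Matrix.mul_apply, Fin.sum_univ_two, Matrix.vecMulVec_apply]
  ring

/-- **`Λ` vanishes on the whole level-one test space `F_1`.** -/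
theorem Λ_fourierFn_eq_zero (c : (ZMod p)ˣ) {c' : Mat p 2 → ℂ} (hc' : RankSupp 1 c') :
    Λ c (fourierFn c') = 0 := by
  classical
  rw [fourierFn_eq_sum_smul, map_sum]
  refine Finset.sum_eq_zero fun M _ => ?_
  rw [map_smul, smul_eq_mul]
  by_cases hM : 1 < M.rank
  · rw [hc' M hM, zero_mul]
  · push Not at hM
    obtain ⟨u, v, rfl⟩ := exists_vecMulVec_of_rank_le_one M hM
    have := Λ_apply_mulVec c
      (fun s t => (ZMod.stdAddChar (v 0 * s + v 1 * t) : ℂ)) (u 0) (u 1)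
    simp only [trace_vecMulVec_mul]
    rw [this, mul_zero]

/-- `uMinus γ ∈ U⁻`. -/
theorem uMinus_mem (γ : ZMod p) : uMinus γ ∈ Uminus p := Finset.mem_image_of_mem _ (Finset.mem_univ _)
/-- `uPlus β ∈ U⁺`. -/
theorem uPlus_mem (β : ZMod p) : uPlus β ∈ Uplus p := Finset.mem_image_of_mem _ (Finset.mem_univ _)
/-- `torU a d ∈ T`. -/
theorem torU_mem (a d : (ZMod p)ˣ) : torU a d ∈ Torus p :=
  Finset.mem_image_of_mem (fun ad : (ZMod p)ˣ × (ZMod p)ˣ => torU ad.1 ad.2) (Finset.mem_univ (a, d))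

/-- `[1 0; 0 1] = 1`. -/
theorem uMinus_zero : uMinus (0 : ZMod p) = 1 := by
  apply Units.ext; simp [Matrix.one_fin_two]

/-- `[1 0; 0 1] = 1`. -/
theorem uPlus_zero : uPlus (0 : ZMod p) = 1 := by
  apply Units.ext; simp [Matrix.one_fin_two]

/-- `uMinus γ = 1 ↔ γ = 0`. -/
theorem uMinus_eq_one_iff (γ : ZMod p) : uMinus γ = 1 ↔ γ = 0 := by
  rw [← uMinus_zero]; exact uMinus_injective.eq_iff

/-- `uPlus β = 1 ↔ β = 0`. -/
theorem uPlus_eq_one_iff (β : ZMod p) : uPlus β = 1 ↔ β = 0 := by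
  rw [← uPlus_zero]; exact uPlus_injective.eq_iff

/-- `diag(a, d) = 1 ↔ a = 1 ∧ d = 1`. -/
theorem torU_eq_one_iff (a d : (ZMod p)ˣ) : torU a d = 1 ↔ a = 1 ∧ d = 1 := by
  rw [← torU_one]
  constructor
  · intro h
    have := torU_injective (a₁ := (a, d)) (a₂ := (1, 1)) h
    exact ⟨(Prod.ext_iff.mp this).1, (Prod.ext_iff.mp this).2⟩
  · rintro ⟨rfl, rfl⟩; rfl

/-- The four-element torus rectangle `R_c = {diag(a, d) : a, d ∈ {1, c}}`. -/
def torusRect (c : (ZMod p)ˣ) : Finset (GLm p 2) := {torU 1 1, torU 1 c, torU c 1, torU c c}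

/-- `R_c ⊆ T`. -/
theorem torusRect_subset_Torus (c : (ZMod p)ˣ) : torusRect c ⊆ Torus p := by
  intro y hy
  simp only [torusRect, Finset.mem_insert, Finset.mem_singleton] at hy
  rcases hy with rfl | rfl | rfl | rfl <;> exact torU_mem _ _

/-- **`Λ_c = 1` from the delta pattern on the LDU blocks**: if a function takes the value
`[γ = 0 ∧ a = d = 1 ∧ β = 0]` at `[1 0; γ 1]·diag(a,d)·[1 β; 0 1]` for all `a, d ∈ {1, c}`, then exactly one of
the four alternating families passes through `1`, so `Λ_c` of it is `1` (for `c ≠ 1`). -/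
theorem Λ_eq_one_of_values {c : (ZMod p)ˣ} (hc : c ≠ 1) {F : GLm p 2 → ℂ}
    (hval : ∀ a d : (ZMod p)ˣ, (a = 1 ∨ a = c) → (d = 1 ∨ d = c) → ∀ β γ : ZMod p,
      F (uMinus γ * torU a d * uPlus β) = if γ = 0 ∧ (a = 1 ∧ d = 1) ∧ β = 0 then 1 else 0) :
    Λ c F = 1 := by
  classical
  rw [Λ_apply]
  have hc1 : ¬ (c = 1) := hc
  simp only [hval 1 1 (Or.inl rfl) (Or.inl rfl), hval 1 c (Or.inl rfl) (Or.inr rfl),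
    hval c 1 (Or.inr rfl) (Or.inl rfl), hval c c (Or.inr rfl) (Or.inr rfl), hc1, and_false, false_and,
    and_true, true_and, if_false, sub_zero, add_zero]
  -- Σ_β Σ_γ [γ = 0 ∧ β = 0] = 1
  rw [Finset.sum_eq_single (0 : ZMod p), Finset.sum_eq_single (0 : ZMod p)]
  · simp
  · intro γ _ hγ; simp [hγ]
  · simp
  · intro β _ hβ; exact Finset.sum_eq_zero fun γ _ => by simp [hβ]
  · simp

/-- **Under separation `Λ` does NOT vanish**: if `X ⊇ U⁻`, `Z ⊇ U⁺`, `Y ⊇ R_c` and `f` separates the target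
`(1, 1)` of `(X, Y, Z)`, then on the LDU blocks `f` is the delta function at `1`, so `Λ_c(f) = 1`. -/
theorem Λ_sep_eq_one {c : (ZMod p)ˣ} (hc : c ≠ 1) {X Y Z : Finset (GLm p 2)} (hX : Uminus p ⊆ X)
    (hY : torusRect c ⊆ Y) (hZ : Uplus p ⊆ Z) {c' : Mat p 2 → ℂ}
    (hsepc : ∀ x ∈ X, ∀ y ∈ Y, ∀ y' ∈ Y, ∀ z ∈ Z,
      fourierFn c' (x⁻¹ * y * y'⁻¹ * z) = if x = uMinus 0 ∧ y = y' ∧ z = uPlus 0 then 1 else 0) :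
    Λ c (fourierFn c') = 1 := by
  classical
  have h11 : torU 1 1 ∈ Y := hY (by simp [torusRect])
  refine Λ_eq_one_of_values hc fun a d ha hd β γ => ?_
  have had : torU a d ∈ Y := by
    apply hY
    rcases ha with rfl | rfl <;> rcases hd with rfl | rfl <;> simp [torusRect]
  have h := hsepc (uMinus (-γ)) (hX (uMinus_mem _)) (torU a d) had (torU 1 1) h11
    (uPlus β) (hZ (uPlus_mem _))
  rw [quad_ldu] at h
  rw [h]
  simp only [uMinus_zero, uPlus_zero, uMinus_eq_one_iff, neg_eq_zero, torU_one, torU_eq_one_iff,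
    uPlus_eq_one_iff]

/-- `U⁻` is a one-parameter subgroup. -/
theorem uMinus_add (γ δ : ZMod p) : uMinus γ * uMinus δ = uMinus (γ + δ) := by
  apply Units.ext; simp

/-- `U⁺` is a one-parameter subgroup. -/
theorem uPlus_add (β δ : ZMod p) : uPlus β * uPlus δ = uPlus (β + δ) := by
  apply Units.ext; simp [add_comm]

/-- `T` is a subgroup. -/
theorem torU_mul (a d a' d' : (ZMod p)ˣ) : torU a d * torU a' d' = torU (a * a') (d * d') := by
  apply Units.ext; simp

/-- `[1 0; γ 1]⁻¹ = [1 0; −γ 1]`. -/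
theorem uMinus_inv (γ : ZMod p) : (uMinus γ)⁻¹ = uMinus (-γ) := by
  rw [← uMinus_neg_inv (-γ), neg_neg]

/-- `[1 β; 0 1]⁻¹ = [1 −β; 0 1]`. -/
theorem uPlus_inv (β : ZMod p) : (uPlus β)⁻¹ = uPlus (-β) := by
  rw [inv_eq_iff_mul_eq_one, uPlus_add, add_neg_cancel, uPlus_zero]

/-- `diag(a, d)⁻¹ = diag(a⁻¹, d⁻¹)`. -/
theorem torU_inv (a d : (ZMod p)ˣ) : (torU a d)⁻¹ = torU a⁻¹ d⁻¹ := by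
  rw [inv_eq_iff_mul_eq_one, torU_mul, mul_inv_cancel, mul_inv_cancel, torU_one]

/-- LDU uniqueness at the identity: `[1 0; γ 1]·diag(a,d)·[1 β; 0 1] = 1` forces all three factors
to be trivial. [folklore] -/
theorem ldu_eq_one {γ β : ZMod p} {a d : (ZMod p)ˣ} (h : uMinus γ * torU a d * uPlus β = 1) :
    γ = 0 ∧ (a = 1 ∧ d = 1) ∧ β = 0 := by
  have hM := congrArg (fun g : GLm p 2 => (g : Mat p 2)) h
  simp only [coe_ldu, Units.val_one] at hM
  have h00 := congrFun (congrFun hM 0) 0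
  have h01 := congrFun (congrFun hM 0) 1
  have h10 := congrFun (congrFun hM 1) 0
  have h11 := congrFun (congrFun hM 1) 1
  simp only [Matrix.of_apply, Matrix.cons_val', Matrix.cons_val_zero, Matrix.cons_val_one,
    Matrix.cons_val_fin_one, Matrix.one_apply_eq, Matrix.one_apply_ne (by decide : (0 : Fin 2) ≠ 1),
    Matrix.one_apply_ne (by decide : (1 : Fin 2) ≠ 0)] at h00 h01 h10 h11
  have ha : a = 1 := Units.ext (by simpa using h00)
  subst ha
  simp only [Units.val_one, one_mul, mul_one] at h01 h10 h11
  subst h01; subst h10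
  simp only [zero_mul, zero_add] at h11
  exact ⟨rfl, ⟨rfl, Units.ext (by simpa using h11)⟩, rfl⟩

/-- **The Borel configuration has the triple product property** (LDU uniqueness). -/
theorem borelConfiguration_tpp :
    Literature.Combinatorics.Additive.TripleProductProperty (Uminus p) (Torus p) (Uplus p) := by
  classical
  intro x hx x' hx' y hy y' hy' z hz z' hz' h1
  simp only [Uminus, Torus, Uplus, Finset.mem_image, Finset.mem_univ, true_and] at hx hx' hy hy' hz hz'
  obtain ⟨γ, rfl⟩ := hx
  obtain ⟨γ', rfl⟩ := hx'
  obtain ⟨⟨a, d⟩, rfl⟩ := hy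
  obtain ⟨⟨a', d'⟩, rfl⟩ := hy'
  obtain ⟨β, rfl⟩ := hz
  obtain ⟨β', rfl⟩ := hz'
  rw [uMinus_inv, uMinus_add, torU_inv, torU_mul, uPlus_inv, uPlus_add] at h1
  obtain ⟨hγ, ⟨ha, hd⟩, hβ⟩ := ldu_eq_one h1
  have hγ' : γ = γ' := by linear_combination hγ
  have hβ' : β = β' := by linear_combination hβ
  simp only [mul_inv_eq_one] at ha hd
  subst hγ' hβ'
  simp only at ha hd ⊢
  rw [ha, hd]
  simp

/-- **Volume of the Borel configuration**: `|U⁻||T||U⁺| = p²(p−1)²` (`= |GL_2(𝔽_p)|·p/(p+1)`). -/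
theorem borelConfiguration_volume :
    (Uminus p).card * (Torus p).card * (Uplus p).card = p ^ 2 * (p - 1) ^ 2 := by
  rw [card_Uminus, card_Torus, card_Uplus]; ring

/-- **FAMILY KILL (supersets of an LDU rectangle).**  If `X ⊇ U⁻`, `Z ⊇ U⁺` and `Y` contains the four
torus elements `diag(a, d)`, `a, d ∈ {1, c}`, for some unit `c ≠ 1`, then `(X, Y, Z)` is NOT rank-1 separated
(whatever else the three sets contain): the alternating LDU functional `Λ_c` annihilates `F_1`
(`Λ_fourierFn_eq_zero`) but equals `1` on a separating function of the target `(1, 1)` (`Λ_sep_eq_one`).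
Already `(U⁻, R_c, U⁺)`, of volume `4p²`, fails.  In matroid language: the `4p²`-element set
`U⁻·R_c·U⁺` is a CIRCUIT of the level-one evaluation matroid through the target `1`. -/
theorem not_rankSep_of_ldu_rectangle {c : (ZMod p)ˣ} (hc : c ≠ 1) {X Y Z : Finset (GLm p 2)}
    (hX : Uminus p ⊆ X) (hY : torusRect c ⊆ Y) (hZ : Uplus p ⊆ Z) : ¬ RankSep 1 X Y Z := by
  classical
  intro hsep
  obtain ⟨c', hc', hsepc⟩ := hsep (uMinus 0) (hX (uMinus_mem 0)) (uPlus 0) (hZ (uPlus_mem 0))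
  have h0 := Λ_fourierFn_eq_zero c hc'
  have h1 := Λ_sep_eq_one hc hX hY hZ hsepc
  rw [h0] at h1
  exact zero_ne_one h1

/-- Two-sided translate `{g x a : x ∈ S}` of a finite set. -/
def translate (g a : GLm p m) (S : Finset (GLm p m)) : Finset (GLm p m) := S.image fun x => g * x * a

/-- Membership in a translate. -/
theorem mem_translate {g a : GLm p m} {S : Finset (GLm p m)} {x' : GLm p m} :
    x' ∈ translate g a S ↔ g⁻¹ * x' * a⁻¹ ∈ S := by
  classical
  unfold translate
  rw [Finset.mem_image]
  constructor
  · rintro ⟨x, hx, rfl⟩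
    simpa [mul_assoc] using hx
  · intro h
    exact ⟨g⁻¹ * x' * a⁻¹, h, by group⟩

/-- **Separation is invariant under two-sided translation** `(X, Y, Z) ↦ (gXa, gYb, gZd)` (the quadruple
products become `a⁻¹ (x⁻¹ y y'⁻¹ z) d`, and `F_k` is bi-invariant, `fourierFn_transl` of the sibling crux). -/
theorem rankSep_translate {k : ℕ} {X Y Z : Finset (GLm p m)} (hsep : RankSep k X Y Z) (g a b d : GLm p m) :
    RankSep k (translate g a X) (translate g b Y) (translate g d Z) := by
  classical
  intro x₀' hx₀' z₀' hz₀'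
  rw [mem_translate] at hx₀' hz₀'
  obtain ⟨c, hc, hsepc⟩ := hsep _ hx₀' _ hz₀'
  refine ⟨transl d⁻¹ a c, rankSupp_transl _ _ hc, fun x' hx' y' hy' y'' hy'' z' hz' => ?_⟩
  rw [mem_translate] at hx' hy' hy'' hz'
  rw [fourierFn_transl]
  have key : a * (x'⁻¹ * y' * y''⁻¹ * z') * d⁻¹ =
      (g⁻¹ * x' * a⁻¹)⁻¹ * (g⁻¹ * y' * b⁻¹) * (g⁻¹ * y'' * b⁻¹)⁻¹ * (g⁻¹ * z' * d⁻¹) := by group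
  rw [key, hsepc _ hx' _ hy' _ hy'' _ hz']
  congr 1
  simp only [eq_iff_iff]
  constructor
  · rintro ⟨h1, h2, h3⟩
    refine ⟨?_, ?_, ?_⟩
    · calc x' = g * (g⁻¹ * x' * a⁻¹) * a := by group
        _ = g * (g⁻¹ * x₀' * a⁻¹) * a := by rw [h1]
        _ = x₀' := by group
    · calc y' = g * (g⁻¹ * y' * b⁻¹) * b := by group
        _ = g * (g⁻¹ * y'' * b⁻¹) * b := by rw [h2]
        _ = y'' := by group
    · calc z' = g * (g⁻¹ * z' * d⁻¹) * d := by group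
        _ = g * (g⁻¹ * z₀' * d⁻¹) * d := by rw [h3]
        _ = z₀' := by group
  · rintro ⟨rfl, rfl, rfl⟩
    exact ⟨rfl, rfl, rfl⟩

/-- **FAMILY KILL, translated form.**  For all `g, a, b, d ∈ GL_2(𝔽_p)` and every unit `c ≠ 1`: if
`X ⊇ g U⁻ a`, `Y ⊇ g R_c b`, `Z ⊇ g U⁺ d` then `(X, Y, Z)` is not rank-1 separated.  (So a rank-1 design never
contains a full coset of a root subgroup on the `X` side, the opposite root subgroup on the `Z` side and a
torus rectangle in `Y`, in matching position.) -/
theorem not_rankSep_of_ldu_rectangle_translate {c : (ZMod p)ˣ} (hc : c ≠ 1) (g a b d : GLm p 2)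
    {X Y Z : Finset (GLm p 2)} (hX : translate g a (Uminus p) ⊆ X) (hY : translate g b (torusRect c) ⊆ Y)
    (hZ : translate g d (Uplus p) ⊆ Z) : ¬ RankSep 1 X Y Z := by
  classical
  intro hsep
  -- pull back by the inverse translation and shrink to the LDU rectangle configuration
  have h' := rankSep_translate hsep g⁻¹ a⁻¹ b⁻¹ d⁻¹
  refine not_rankSep_of_ldu_rectangle hc ?_ ?_ ?_ h'
  · intro x hx
    rw [mem_translate, inv_inv, inv_inv]
    exact hX (Finset.mem_image_of_mem _ hx)
  · intro y hy
    rw [mem_translate, inv_inv, inv_inv]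
    exact hY (Finset.mem_image_of_mem _ hy)
  · intro z hz
    rw [mem_translate, inv_inv, inv_inv]
    exact hZ (Finset.mem_image_of_mem _ hz)

/-- For `p ≠ 2` the unit `2 ∈ 𝔽_pˣ` is `≠ 1`. -/
theorem two_unit_ne_one (hp : p ≠ 2) :
    ∃ c : (ZMod p)ˣ, c ≠ 1 := by
  have h2 : (2 : ZMod p) ≠ 0 := by
    intro h
    have := (ZMod.natCast_eq_zero_iff 2 p).mp (by exact_mod_cast h)
    have hp2 : p ≤ 2 := Nat.le_of_dvd two_pos this
    have := (Fact.out : p.Prime).two_le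
    omega
  refine ⟨Units.mk0 2 h2, fun h => ?_⟩
  have : ((Units.mk0 (2 : ZMod p) h2 : (ZMod p)ˣ) : ZMod p) = 1 := by rw [h]; rfl
  rw [Units.val_mk0] at this
  have h21 : ((2 : ℕ) : ZMod p) = ((1 : ℕ) : ZMod p) := by exact_mod_cast this
  rw [ZMod.natCast_eq_natCast_iff'] at h21
  have := (Fact.out : p.Prime).two_le
  rw [Nat.mod_eq_of_lt (by omega), Nat.mod_eq_of_lt (by omega)] at h21
  omega

/-- **FAMILY KILL (every prime `p ≠ 2`): the Borel configuration `(U⁻, T, U⁺)` of `GL_2(𝔽_p)` is NOT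
rank-1 separated** — although it has the TPP (`borelConfiguration_tpp`) and volume `p²(p−1)²`
(`borelConfiguration_volume`), the prime-field frontier `|G|·p/(p+1)` named in the crux text.  The same
functional with `(g₂₂, det g / g₂₂)` in place of `(g₁₁, det g / g₁₁)` kills the mirror configuration
`(Aff⁺, T₂, U⁻)` (confirmed numerically at `p = 3, 5` by kit j008119 of the sibling chain); more generally
every triple whose quadruple-product set contains a translate of `U⁻·R_c·U⁺` through a target fails
(`not_rankSep_of_ldu_rectangle`). -/
theorem not_rankSep_borelConfiguration (hp : p ≠ 2) : ¬ RankSep 1 (Uminus p) (Torus p) (Uplus p) := by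
  obtain ⟨c, hc⟩ := two_unit_ne_one hp
  exact not_rankSep_of_ldu_rectangle hc subset_rfl (torusRect_subset_Torus c) subset_rfl

/-- The one-dimensional tori `T₁ = {diag(a, 1)}` and `T₂ = {diag(1, d)}`. -/
def TorusOne (p : ℕ) [Fact p.Prime] : Finset (GLm p 2) :=
  (Finset.univ : Finset (ZMod p)ˣ).image fun a => torU a 1

/-- `T₂ = {diag(1, d)}`. -/
def TorusTwo (p : ℕ) [Fact p.Prime] : Finset (GLm p 2) :=
  (Finset.univ : Finset (ZMod p)ˣ).image fun d => torU 1 d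

/-- The affine group `Aff⁺ = {[a b; 0 1]} = T₁ U⁺`. -/
def AffPlus (p : ℕ) [Fact p.Prime] : Finset (GLm p 2) :=
  (Finset.univ : Finset ((ZMod p)ˣ × ZMod p)).image fun ab => torU ab.1 1 * uPlus ab.2

/-- The lower affine group `{[1 0; c d]} = U⁻ T₂`. -/
def AffMinus (p : ℕ) [Fact p.Prime] : Finset (GLm p 2) :=
  (Finset.univ : Finset (ZMod p × (ZMod p)ˣ)).image fun cd => uMinus cd.1 * torU 1 cd.2

/-- **The mirror configuration `(U⁻T₂, T₁, U⁺)` is not rank-1 separated**: its LDU blocks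
`[1 0; γ 1]·diag(a,d)·[1 β; 0 1] = (uMinus γ · diag(1,d)) · diag(a,1) · 1⁻¹ · uPlus β` are quadruple products
with `x ∈ U⁻T₂`, `y, y' ∈ T₁`, `z ∈ U⁺` (the torus rectangle is assembled from `X`'s torus `T₂` and `Y = T₁`),
so `Λ_c` of a separating function of the target `(1,1)` is `1`, against `Λ_c(F_1) = 0`. -/
theorem not_rankSep_affMinus_torusOne_uPlus (hp : p ≠ 2) : ¬ RankSep 1 (AffMinus p) (TorusOne p) (Uplus p) := by
  classical
  obtain ⟨c, hc⟩ := two_unit_ne_one hp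
  intro hsep
  have hx0 : (1 : GLm p 2) ∈ AffMinus p :=
    Finset.mem_image.mpr ⟨(0, 1), Finset.mem_univ _, by rw [uMinus_zero, torU_one, one_mul]⟩
  have hz0 : (1 : GLm p 2) ∈ Uplus p := by rw [← uPlus_zero]; exact uPlus_mem 0
  obtain ⟨c', hc', hsepc⟩ := hsep 1 hx0 1 hz0
  have h0 := Λ_fourierFn_eq_zero c hc'
  have h1 : Λ c (fourierFn c') = 1 := by
    refine Λ_eq_one_of_values hc fun a d _ _ β γ => ?_
    -- x := (uMinus γ · diag(1,d))⁻¹ = uMinus(−γ/d) · diag(1, d⁻¹) ∈ U⁻T₂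
    have hcomm : ∀ (e : (ZMod p)ˣ) (c₀ : ZMod p), torU 1 e * uMinus c₀ = uMinus ((e : ZMod p) * c₀) * torU 1 e := by
      intro e c₀
      apply Units.ext
      simp [mul_comm]
    have hxinv : (uMinus γ * torU 1 d)⁻¹ = uMinus (((d⁻¹ : (ZMod p)ˣ) : ZMod p) * (-γ)) * torU 1 d⁻¹ := by
      rw [mul_inv_rev, torU_inv, inv_one, uMinus_inv, hcomm]
    have hx : (uMinus γ * torU 1 d)⁻¹ ∈ AffMinus p := by
      rw [hxinv]; exact Finset.mem_image.mpr ⟨(_, d⁻¹), Finset.mem_univ _, rfl⟩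
    have hy : torU a 1 ∈ TorusOne p := Finset.mem_image.mpr ⟨a, Finset.mem_univ _, rfl⟩
    have hy' : torU 1 1 ∈ TorusOne p := Finset.mem_image.mpr ⟨1, Finset.mem_univ _, rfl⟩
    have h := hsepc _ hx (torU a 1) hy (torU 1 1) hy' (uPlus β) (uPlus_mem β)
    rw [inv_inv, torU_one, inv_one, mul_one, mul_assoc (uMinus γ), torU_mul, one_mul, mul_one] at h
    rw [h]
    have hld : (uMinus γ * torU 1 d)⁻¹ = 1 ↔ γ = 0 ∧ d = 1 := by
      rw [inv_eq_one]
      constructor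
      · intro h1
        have := ldu_eq_one (γ := γ) (β := 0) (a := 1) (d := d) (by rw [uPlus_zero, mul_one, h1])
        exact ⟨this.1, this.2.1.2⟩
      · rintro ⟨rfl, rfl⟩
        rw [uMinus_zero, torU_one, one_mul]
    have hta : torU a 1 = 1 ↔ a = 1 := by
      rw [torU_eq_one_iff]; simp
    simp only [hld, hta, uPlus_eq_one_iff]
    congr 1
    simp only [eq_iff_iff]
    tauto
  rw [h0] at h1
  exact zero_ne_one h1

/-- The Weyl element `w = [0 1; 1 0]`. -/
def weyl : GLm p 2 := Matrix.GeneralLinearGroup.mkOfDetNeZero !![0, 1; 1, 0] (by simp [Matrix.det_fin_two])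

/-- `w² = 1`. -/
theorem weyl_mul_weyl : (weyl : GLm p 2) * weyl = 1 := by
  apply Units.ext; simp [weyl, Matrix.one_fin_two]

/-- `w⁻¹ = w`. -/
theorem weyl_inv : (weyl : GLm p 2)⁻¹ = weyl := inv_eq_of_mul_eq_one_right weyl_mul_weyl

/-- `w · diag(a,1)·[1 b; 0 1] · w⁻¹ = [1 0; ab a] = uMinus(ab)·diag(1,a)`. -/
theorem weyl_conj_aff (a : (ZMod p)ˣ) (b : ZMod p) :
    weyl * (torU a 1 * uPlus b) * weyl⁻¹ = uMinus ((a : ZMod p) * b) * torU 1 a := by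
  rw [weyl_inv]; apply Units.ext; simp [weyl, mul_comm]

/-- `w · diag(1,d) · w⁻¹ = diag(d,1)`. -/
theorem weyl_conj_torusTwo (d : (ZMod p)ˣ) : weyl * torU 1 d * weyl⁻¹ = torU d 1 := by
  rw [weyl_inv]; apply Units.ext; simp [weyl]

/-- `w · [1 0; c 1] · w⁻¹ = [1 c; 0 1]`. -/
theorem weyl_conj_uMinus (c : ZMod p) : weyl * uMinus c * weyl⁻¹ = uPlus c := by
  rw [weyl_inv]; apply Units.ext; simp [weyl]

/-- Conjugating `Aff⁺` by `w` gives the lower affine group. -/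
theorem translate_weyl_affPlus : translate weyl weyl⁻¹ (AffPlus p) = AffMinus p := by
  classical
  ext g
  rw [mem_translate, inv_inv, weyl_inv]
  simp only [AffPlus, AffMinus, Finset.mem_image, Finset.mem_univ, true_and]
  constructor
  · rintro ⟨⟨a, b⟩, h⟩
    refine ⟨((a : ZMod p) * b, a), ?_⟩
    have := congrArg (fun x => weyl * x * weyl⁻¹) h
    simp only at this
    rw [weyl_conj_aff, weyl_inv, show weyl * (weyl * g * weyl) * weyl = g by
      rw [← mul_assoc, ← mul_assoc, weyl_mul_weyl, one_mul, mul_assoc, weyl_mul_weyl, mul_one]] at this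
    exact this
  · rintro ⟨⟨c, d⟩, rfl⟩
    refine ⟨(d, (d⁻¹ : (ZMod p)ˣ) * c), ?_⟩
    have h := weyl_conj_aff (p := p) d (((d⁻¹ : (ZMod p)ˣ) : ZMod p) * c)
    rw [weyl_inv, ← mul_assoc (d : ZMod p), ← Units.val_mul, mul_inv_cancel, Units.val_one, one_mul] at h
    rw [← h, weyl_inv.symm]
    rw [weyl_inv]
    rw [show weyl * (weyl * (torU d 1 * uPlus (((d⁻¹ : (ZMod p)ˣ) : ZMod p) * c)) * weyl) * weyl =
      torU d 1 * uPlus (((d⁻¹ : (ZMod p)ˣ) : ZMod p) * c) by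
      rw [← mul_assoc, ← mul_assoc, weyl_mul_weyl, one_mul, mul_assoc, weyl_mul_weyl, mul_one]]

/-- Conjugating `T₂` by `w` gives `T₁`. -/
theorem translate_weyl_torusTwo : translate weyl weyl⁻¹ (TorusTwo p) = TorusOne p := by
  classical
  ext g
  rw [mem_translate, inv_inv, weyl_inv]
  simp only [TorusTwo, TorusOne, Finset.mem_image, Finset.mem_univ, true_and]
  constructor
  · rintro ⟨d, h⟩
    refine ⟨d, ?_⟩
    have := congrArg (fun x => weyl * x * weyl⁻¹) h
    rw [weyl_conj_torusTwo, weyl_inv, show weyl * (weyl * g * weyl) * weyl = g by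
      rw [← mul_assoc, ← mul_assoc, weyl_mul_weyl, one_mul, mul_assoc, weyl_mul_weyl, mul_one]] at this
    exact this
  · rintro ⟨a, rfl⟩
    refine ⟨a, ?_⟩
    have h := weyl_conj_torusTwo (p := p) a
    rw [weyl_inv] at h
    rw [← h, show weyl * (weyl * torU 1 a * weyl) * weyl = torU 1 a by
      rw [← mul_assoc, ← mul_assoc, weyl_mul_weyl, one_mul, mul_assoc, weyl_mul_weyl, mul_one]]

/-- Conjugating `U⁻` by `w` gives `U⁺`. -/
theorem translate_weyl_uMinus : translate weyl weyl⁻¹ (Uminus p) = Uplus p := by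
  classical
  ext g
  rw [mem_translate, inv_inv, weyl_inv]
  simp only [Uminus, Uplus, Finset.mem_image, Finset.mem_univ, true_and]
  constructor
  · rintro ⟨c, h⟩
    refine ⟨c, ?_⟩
    have := congrArg (fun x => weyl * x * weyl⁻¹) h
    rw [weyl_conj_uMinus, weyl_inv, show weyl * (weyl * g * weyl) * weyl = g by
      rw [← mul_assoc, ← mul_assoc, weyl_mul_weyl, one_mul, mul_assoc, weyl_mul_weyl, mul_one]] at this
    exact this
  · rintro ⟨b, rfl⟩
    refine ⟨b, ?_⟩
    have h := weyl_conj_uMinus (p := p) b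
    rw [weyl_inv] at h
    rw [← h, show weyl * (weyl * uMinus b * weyl) * weyl = uMinus b by
      rw [← mul_assoc, ← mul_assoc, weyl_mul_weyl, one_mul, mul_assoc, weyl_mul_weyl, mul_one]]

/-- **The prime-field frontier triple `(Aff⁺, T₂, U⁻)` named in the crux text is NOT a rank-1 design**
(every prime `p ≠ 2`): it is TPP with volume `p²(p−1)²`, but `w`-conjugate to the mirror configuration
`(U⁻T₂, T₁, U⁺)`, which fails (`not_rankSep_affMinus_torusOne_uPlus`).  So the "factor `1 + 4/p`" framing of the
`(2,1)` rung rests on a triple that is not separated; the verified rank-1 frontier for `X ⊇ U⁻`, `Z ⊇ U⁺` designs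
is what the kit searches measure (known: `(U⁻, T₁, U⁺)`, `V = p²(p−1)`). -/
theorem not_rankSep_affPlus_torusTwo_uMinus (hp : p ≠ 2) : ¬ RankSep 1 (AffPlus p) (TorusTwo p) (Uminus p) := by
  intro hsep
  have h := rankSep_translate hsep weyl weyl⁻¹ weyl⁻¹ weyl⁻¹
  rw [translate_weyl_affPlus, translate_weyl_torusTwo, translate_weyl_uMinus] at h
  exact not_rankSep_affMinus_torusOne_uPlus hp h

end BorelConfiguration



/-! ## The circuit criterion (general `m`, `k`): balanced weightings through a target kill separation -/

section Circuit

variable [Fact p.Prime] {k : ℕ}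

/-- **CIRCUIT CRITERION (the negative half of the coloop/matroid description of separation).**  Let `h` be a
weighting of group elements which is BALANCED against level `k` — `Σ_g h(g) f(g) = 0` for every level-`k`
Fourier function `f` — and supported inside the quadruple-product set `Q = X⁻¹YY⁻¹Z` of a triple.  If `h` does
not vanish at some target `x₀⁻¹z₀`, the triple is NOT `F_k`-separated: pairing `h` with the separating function
of that target gives `h(x₀⁻¹z₀)·1 + Σ_{off-target} h·0 = 0`.  Every family kill in this file is an instance
(`h` = the alternating LDU rectangle); other circuits of the level-one matroid of `GL_2(𝔽_p)` (e.g. the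
`4(p−1)`-element ones inside `N(T)`: `±` on `{t ∈ T : det t ∈ {c, c'}} ∪ {n ∈ wT : −det n ∈ {c, c'}}`) give
further instances. -/
theorem not_rankSep_of_balanced {X Y Z : Finset (GLm p m)} (h : GLm p m → ℂ)
    (hbal : ∀ c : Mat p m → ℂ, RankSupp k c → ∑ g : GLm p m, h g * fourierFn c g = 0)
    (hsupp : ∀ g, h g ≠ 0 → ∃ x ∈ X, ∃ y ∈ Y, ∃ y' ∈ Y, ∃ z ∈ Z, g = x⁻¹ * y * y'⁻¹ * z)
    {x₀ z₀ : GLm p m} (hx₀ : x₀ ∈ X) (hz₀ : z₀ ∈ Z) (ht : h (x₀⁻¹ * z₀) ≠ 0) : ¬ RankSep k X Y Z := by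
  classical
  intro hsep
  obtain ⟨c, hc, hsepc⟩ := hsep x₀ hx₀ z₀ hz₀
  have hY : Y.Nonempty := by
    by_contra hY
    rw [Finset.not_nonempty_iff_eq_empty] at hY
    obtain ⟨x, -, y, hy, -⟩ := hsupp _ ht
    rw [hY] at hy
    exact absurd hy (Finset.notMem_empty y)
  obtain ⟨y₀, hy₀⟩ := hY
  -- on the support, the separating function is the delta at the target
  have hval : ∀ g, h g ≠ 0 → fourierFn c g = if g = x₀⁻¹ * z₀ then 1 else 0 := by
    intro g hg
    obtain ⟨x, hx, y, hy, y', hy', z, hz, rfl⟩ := hsupp g hg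
    rw [hsepc x hx y hy y' hy' z hz]
    by_cases heq : x⁻¹ * y * y'⁻¹ * z = x₀⁻¹ * z₀
    · rw [if_pos heq]
      have h1 := hsepc x₀ hx₀ y hy y hy z₀ hz₀
      rw [if_pos ⟨rfl, rfl, rfl⟩, show x₀⁻¹ * y * y⁻¹ * z₀ = x₀⁻¹ * z₀ by group, ← heq,
        hsepc x hx y hy y' hy' z hz] at h1
      exact h1
    · rw [if_neg heq, if_neg]
      rintro ⟨rfl, rfl, rfl⟩
      exact heq (by group)
  have hsum := hbal c hc
  have : ∑ g : GLm p m, h g * fourierFn c g = h (x₀⁻¹ * z₀) := by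
    rw [Finset.sum_eq_single (x₀⁻¹ * z₀)]
    · rw [hval _ ht, if_pos rfl, mul_one]
    · intro g _ hg
      by_cases hg0 : h g = 0
      · rw [hg0, zero_mul]
      · rw [hval g hg0, if_neg hg, mul_zero]
    · intro hh; exact absurd (Finset.mem_univ _) hh
  rw [this] at hsum
  exact ht hsum

end Circuit

/-! ## Sharper wall for `GL_2`, level one: `dim F_1|_G ≤ (p+1)(p²−1) − p = p³ + p² − 2p − 1` -/

section DimBound

variable [Fact p.Prime]

/-- Direction representatives of `P¹(𝔽_p)`: `(1, 0)` and `(m, 1)`. -/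
def dirVec : Option (ZMod p) → (Fin 2 → ZMod p)
  | none => ![1, 0]
  | some m => ![m, 1]

/-- Every nonzero vector of `𝔽_p²` is a nonzero multiple of a direction representative. -/
theorem exists_smul_dirVec {a : Fin 2 → ZMod p} (ha : a ≠ 0) :
    ∃ (ℓ : Option (ZMod p)) (t : ZMod p), t ≠ 0 ∧ a = t • dirVec ℓ := by
  by_cases h1 : a 1 = 0
  · refine ⟨none, a 0, fun h0 => ha ?_, ?_⟩
    · funext i; fin_cases i <;> simp [h0, h1]
    · funext i; fin_cases i <;> simp [dirVec, h1]
  · refine ⟨some (a 0 / a 1), a 1, h1, ?_⟩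
    funext i; fin_cases i
    · simp [dirVec]; field_simp
    · simp [dirVec]

/-- Indicator of the cell `{g : g u = w}`. -/
def cellInd (u w : Fin 2 → ZMod p) (g : GLm p 2) : ℂ := if Matrix.mulVec (g : Mat p 2) u = w then 1 else 0

/-- An invertible matrix does not kill a nonzero vector. -/
theorem mulVec_ne_zero (g : GLm p 2) {u : Fin 2 → ZMod p} (hu : u ≠ 0) :
    Matrix.mulVec (g : Mat p 2) u ≠ 0 := by
  intro h
  apply hu
  have : Matrix.mulVec ((g⁻¹ : GLm p 2) : Mat p 2) (Matrix.mulVec (g : Mat p 2) u) = u := by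
    rw [Matrix.mulVec_mulVec, ← Units.val_mul, inv_mul_cancel, Units.val_one, Matrix.one_mulVec]
  rw [← this, h, Matrix.mulVec_zero]

/-- **Partition of unity**: `Σ_{w ≠ 0} [g u = w] = 1` for `u ≠ 0`. -/
theorem sum_cellInd {u : Fin 2 → ZMod p} (hu : u ≠ 0) (g : GLm p 2) :
    ∑ w ∈ (Finset.univ : Finset (Fin 2 → ZMod p)).filter (· ≠ 0), cellInd u w g = 1 := by
  classical
  unfold cellInd
  rw [Finset.sum_ite_eq, if_pos]
  exact Finset.mem_filter.mpr ⟨Finset.mem_univ _, mulVec_ne_zero g hu⟩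

/-- Index set of the generating indicators: all `(ℓ, w)` with `w ≠ 0`, except the `p` pairs `(ℓ, (1,0))`,
`ℓ ≠ (1:0)` (dropped by the partition-of-unity relations). -/
def genIndex (p : ℕ) [Fact p.Prime] : Finset (Option (ZMod p) × (Fin 2 → ZMod p)) :=
  Finset.univ.filter fun ℓw => ℓw.2 ≠ 0 ∧ ¬ (ℓw.1 ≠ none ∧ ℓw.2 = ![1, 0])

/-- The generating family of indicator functions. -/
def genSet (p : ℕ) [Fact p.Prime] : Finset (GLm p 2 → ℂ) :=
  (genIndex p).image fun ℓw => cellInd (dirVec ℓw.1) ℓw.2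

/-- `|genIndex| = (p + 1)(p² − 1) − p`. -/
theorem card_genIndex : (genIndex p).card = (p + 1) * (p ^ 2 - 1) - p := by
  classical
  -- all pairs with w ≠ 0
  set A : Finset (Option (ZMod p) × (Fin 2 → ZMod p)) := Finset.univ.filter fun ℓw => ℓw.2 ≠ 0 with hA
  set Bd : Finset (Option (ZMod p) × (Fin 2 → ZMod p)) :=
    Finset.univ.filter fun ℓw => ℓw.1 ≠ none ∧ ℓw.2 = ![1, 0] with hBd
  have hsub : Bd ⊆ A := by
    intro x hx
    simp only [hBd, hA, Finset.mem_filter, Finset.mem_univ, true_and] at hx ⊢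
    rw [hx.2]
    intro h
    have := congrFun h 0
    simp at this
  have hgen : genIndex p = A \ Bd := by
    ext x
    simp only [genIndex, hA, hBd, Finset.mem_filter, Finset.mem_univ, true_and, Finset.mem_sdiff]
  have hcardA : A.card = (p + 1) * (p ^ 2 - 1) := by
    have : A = Finset.univ ×ˢ (Finset.univ.filter fun w : Fin 2 → ZMod p => w ≠ 0) := by
      ext x; simp [hA]
    rw [this, Finset.card_product, Finset.card_univ, Fintype.card_option, ZMod.card,
      Finset.filter_ne' Finset.univ (0 : Fin 2 → ZMod p), Finset.card_erase_of_mem (Finset.mem_univ _),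
      Finset.card_univ, Fintype.card_pi, Finset.prod_const, Finset.card_univ, Fintype.card_fin, ZMod.card]
  have hcardB : Bd.card = p := by
    have : Bd = (Finset.univ.filter fun ℓ : Option (ZMod p) => ℓ ≠ none).image fun ℓ => (ℓ, ![1, 0]) := by
      ext x
      simp only [hBd, Finset.mem_filter, Finset.mem_univ, true_and, Finset.mem_image]
      constructor
      · rintro ⟨h1, h2⟩; exact ⟨x.1, h1, by rw [← h2]⟩
      · rintro ⟨ℓ, hℓ, rfl⟩; exact ⟨hℓ, rfl⟩
    rw [this, Finset.card_image_of_injective _ (fun a b h => (Prod.ext_iff.mp h).1),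
      Finset.filter_ne' Finset.univ none, Finset.card_erase_of_mem (Finset.mem_univ _), Finset.card_univ,
      Fintype.card_option, ZMod.card]
    simp
  rw [hgen, Finset.card_sdiff_of_subset hsub, hcardA, hcardB]

/-- Every indicator `[g u_ℓ = w]`, `w ≠ 0`, lies in the span of the generating family (the dropped ones by
the partition-of-unity relations `Σ_w [g u_ℓ = w] = 1 = Σ_w [g u₀ = w]`). -/
theorem cellInd_mem_span (ℓ : Option (ZMod p)) {w : Fin 2 → ZMod p} (hw : w ≠ 0) :
    (cellInd (dirVec ℓ) w : GLm p 2 → ℂ) ∈ Submodule.span ℂ (genSet p : Set (GLm p 2 → ℂ)) := by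
  classical
  by_cases hdrop : ℓ ≠ none ∧ w = ![1, 0]
  · -- the dropped indicator: [g u_ℓ = w₀] = Σ_{w'} [g u₀ = w'] − Σ_{w' ≠ w₀} [g u_ℓ = w']
    obtain ⟨hℓ, rfl⟩ := hdrop
    have hu0 : dirVec (none : Option (ZMod p)) ≠ 0 := by
      intro h; have := congrFun h 0; simp [dirVec] at this
    have huℓ : dirVec ℓ ≠ 0 := by
      intro h; have := congrFun h 1
      obtain ⟨m, rfl⟩ := Option.ne_none_iff_exists'.mp hℓ
      simp [dirVec] at this
    set S := (Finset.univ : Finset (Fin 2 → ZMod p)).filter (· ≠ 0) with hS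
    have hw0S : (![1, 0] : Fin 2 → ZMod p) ∈ S := by
      rw [hS, Finset.mem_filter]; refine ⟨Finset.mem_univ _, fun h => ?_⟩
      have := congrFun h 0; simp at this
    have key : (cellInd (dirVec ℓ) ![1, 0] : GLm p 2 → ℂ) =
        (∑ w' ∈ S, cellInd (dirVec none) w') - ∑ w' ∈ S.erase ![1, 0], cellInd (dirVec ℓ) w' := by
      funext g
      have h1 := sum_cellInd hu0 g
      have h2 := sum_cellInd huℓ g
      rw [← hS] at h1 h2
      rw [← Finset.add_sum_erase S _ hw0S] at h2
      simp only [Pi.sub_apply, Finset.sum_apply]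
      rw [h1]
      linear_combination h2
    rw [key]
    refine Submodule.sub_mem _ (Submodule.sum_mem _ fun w' hw' => ?_) (Submodule.sum_mem _ fun w' hw' => ?_)
    · refine Submodule.subset_span (Finset.mem_coe.mpr (Finset.mem_image.mpr ⟨(none, w'), ?_, rfl⟩))
      simp only [genIndex, Finset.mem_filter, Finset.mem_univ, true_and, ne_eq, not_true_eq_false,
        false_and, not_false_eq_true, and_true]
      exact (Finset.mem_filter.mp hw').2
    · refine Submodule.subset_span (Finset.mem_coe.mpr (Finset.mem_image.mpr ⟨(ℓ, w'), ?_, rfl⟩))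
      simp only [genIndex, Finset.mem_filter, Finset.mem_univ, true_and]
      exact ⟨(Finset.mem_filter.mp (Finset.mem_of_mem_erase hw')).2, fun h => Finset.ne_of_mem_erase hw' h.2⟩
  · refine Submodule.subset_span (Finset.mem_coe.mpr (Finset.mem_image.mpr ⟨(ℓ, w), ?_, rfl⟩))
    simp only [genIndex, Finset.mem_filter, Finset.mem_univ, true_and]
    exact ⟨hw, hdrop⟩

/-- A rank-one Fourier mode is a combination of indicators of one direction:
`ψ(tr(u vᵀ g)) = Σ_{w ≠ 0} ψ(v ⬝ (t w)) [g u_ℓ = w]` for `u = t u_ℓ`. -/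
theorem psi_trace_vecMulVec_eq_sum (ℓ : Option (ZMod p)) {t : ZMod p} (v : Fin 2 → ZMod p)
    (g : GLm p 2) :
    (ZMod.stdAddChar (Matrix.trace (Matrix.vecMulVec (t • dirVec ℓ) v * (g : Mat p 2))) : ℂ) =
      ∑ w ∈ (Finset.univ : Finset (Fin 2 → ZMod p)).filter (· ≠ 0),
        (ZMod.stdAddChar (v ⬝ᵥ (t • w)) : ℂ) * cellInd (dirVec ℓ) w g := by
  classical
  have hne : dirVec ℓ ≠ (0 : Fin 2 → ZMod p) := by
    cases ℓ with
    | none => intro h; have := congrFun h 0; simp [dirVec] at this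
    | some m => intro h; have := congrFun h 1; simp [dirVec] at this
  have hmem : Matrix.mulVec (g : Mat p 2) (dirVec ℓ) ∈ (Finset.univ : Finset (Fin 2 → ZMod p)).filter (· ≠ 0) :=
    Finset.mem_filter.mpr ⟨Finset.mem_univ _, mulVec_ne_zero g hne⟩
  unfold cellInd
  simp_rw [mul_ite, mul_one, mul_zero]
  rw [Finset.sum_ite_eq, if_pos hmem]
  congr 1
  rw [trace_vecMulVec_mul]
  simp only [Pi.smul_apply, smul_eq_mul, Matrix.mulVec, dotProduct, Fin.sum_univ_two]
  ring

/-- **The level-one test space of `GL_2(𝔽_p)` is spanned by the generating indicators.** -/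
theorem levelSubmodule_le_span : levelSubmodule p 2 1 ≤ Submodule.span ℂ (genSet p : Set (GLm p 2 → ℂ)) := by
  classical
  intro f hf
  rw [mem_levelSubmodule_iff] at hf
  obtain ⟨c, hc, hfc⟩ := hf
  have hf' : f = fourierFn c := funext hfc
  rw [hf', fourierFn_eq_sum_smul c]
  refine Submodule.sum_mem _ fun M _ => ?_
  by_cases hM : 1 < M.rank
  · rw [hc M hM, zero_smul]; exact Submodule.zero_mem _
  push Not at hM
  refine Submodule.smul_mem _ _ ?_
  obtain ⟨a, b, rfl⟩ := exists_vecMulVec_of_rank_le_one M hM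
  by_cases ha : a = 0
  · -- the constant function 1 = Σ_w [g u₀ = w]
    subst ha
    have hu0 : dirVec (none : Option (ZMod p)) ≠ 0 := by
      intro h; have := congrFun h 0; simp [dirVec] at this
    have key : (fun g : GLm p 2 => (ZMod.stdAddChar (Matrix.trace (Matrix.vecMulVec 0 b * (g : Mat p 2))) : ℂ))
        = ∑ w ∈ (Finset.univ : Finset (Fin 2 → ZMod p)).filter (· ≠ 0), cellInd (dirVec none) w := by
      funext g
      rw [Finset.sum_apply, sum_cellInd hu0 g, trace_vecMulVec_mul]
      simp
    rw [key]
    exact Submodule.sum_mem _ fun w hw => cellInd_mem_span none (Finset.mem_filter.mp hw).2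
  · obtain ⟨ℓ, t, ht, rfl⟩ := exists_smul_dirVec ha
    have key : (fun g : GLm p 2 =>
        (ZMod.stdAddChar (Matrix.trace (Matrix.vecMulVec (t • dirVec ℓ) b * (g : Mat p 2))) : ℂ)) =
        ∑ w ∈ (Finset.univ : Finset (Fin 2 → ZMod p)).filter (· ≠ 0),
          (ZMod.stdAddChar (b ⬝ᵥ (t • w)) : ℂ) • cellInd (dirVec ℓ) w := by
      funext g
      rw [psi_trace_vecMulVec_eq_sum, Finset.sum_apply]
      simp only [Pi.smul_apply, smul_eq_mul]
    rw [key]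
    exact Submodule.sum_mem _ fun w hw =>
      Submodule.smul_mem _ _ (cellInd_mem_span ℓ (Finset.mem_filter.mp hw).2)

/-- **Sharper wall.** `dim F_1|_{GL_2(𝔽_p)} ≤ (p + 1)(p² − 1) − p = p³ + p² − 2p − 1` (generators = cell indicators
over the `p + 1` directions, minus the `p` partition-of-unity relations; the true value is `p³ + p² − 3p − 1`,
the remaining `p` relations being the line relations `Σ_ℓ Σ_{w ∈ L} [g u_ℓ = w] = 1`). -/
theorem finrank_levelSubmodule_two_one_le :
    Module.finrank ℂ (levelSubmodule p 2 1) ≤ (p + 1) * (p ^ 2 - 1) - p := by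
  classical
  calc Module.finrank ℂ (levelSubmodule p 2 1)
      ≤ Module.finrank ℂ (Submodule.span ℂ (genSet p : Set (GLm p 2 → ℂ))) :=
        Submodule.finrank_mono levelSubmodule_le_span
    _ ≤ (genSet p).card := finrank_span_finset_le_card _
    _ ≤ (genIndex p).card := Finset.card_image_le
    _ = (p + 1) * (p ^ 2 - 1) - p := card_genIndex

variable {X Y Z : Finset (GLm p 2)}

/-- Graded Neumann count for rank-1 separation in `GL_2(𝔽_p)` with the sharper wall, `X`-slab. -/
theorem neumann_X_dim (hsep : RankSep 1 X Y Z) {y₁ z₁ : GLm p 2} (hy₁ : y₁ ∈ Y) (hz₁ : z₁ ∈ Z) :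
    X.card * Z.card + X.card * (Y.card - 1) ≤ (p + 1) * (p ^ 2 - 1) - p :=
  (Summit.MatrixMultiplication.MatrixMultiplication.Theorems.LevelTwoBeatsCubes.Negative.packing_X
    (levelSubmodule p 2 1) levelSubmodule_right_inv X Y Z (sep_clause_of_rankSep hsep) hy₁ hz₁).trans
    finrank_levelSubmodule_two_one_le

/-- Graded Neumann count for rank-1 separation in `GL_2(𝔽_p)` with the sharper wall, `Z`-slab. -/
theorem neumann_Z_dim (hsep : RankSep 1 X Y Z) {x₁ y₁ : GLm p 2} (hx₁ : x₁ ∈ X) (hy₁ : y₁ ∈ Y) :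
    X.card * Z.card + (Y.card - 1) * Z.card ≤ (p + 1) * (p ^ 2 - 1) - p :=
  (Summit.MatrixMultiplication.MatrixMultiplication.Theorems.LevelTwoBeatsCubes.Negative.packing_Z
    (levelSubmodule p 2 1) levelSubmodule_left_inv X Y Z (sep_clause_of_rankSep hsep) hx₁ hy₁).trans
    finrank_levelSubmodule_two_one_le

/-- **Exact integer cap.**  From the two packing counts: `abc ≤ B` as soon as
`m M (1 + ⌊(N − mM)/M⌋) ≤ B` for all `1 ≤ m ≤ M`, `mM ≤ N` (with `m = min(a,c)`, `M = max(a,c)`,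
`|Y| ≤ 1 + ⌊(N − mM)/M⌋`).  Sharper than the real relaxation `mN + m² − m³` of `cube_cap`
(e.g. `N = 377`: `2904` versus `2937`). -/
theorem cube_cap_exact (a b c N B : ℕ) (h1 : a * c + a * (b - 1) ≤ N) (h2 : a * c + (b - 1) * c ≤ N)
    (hB : ∀ m M : ℕ, 1 ≤ m → m ≤ M → m * M ≤ N → m * M * (1 + (N - m * M) / M) ≤ B) :
    a * b * c ≤ B := by
  rcases Nat.eq_zero_or_pos b with rfl | hb
  · simp
  wlog hac : a ≤ c generalizing a c
  · have := this c a (by linarith) (by linarith) (le_of_not_ge hac)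
    linarith [this, show a * b * c = c * b * a by ring]
  rcases Nat.eq_zero_or_pos a with rfl | ha
  · simp
  have hc : 0 < c := lt_of_lt_of_le ha hac
  obtain ⟨b', rfl⟩ : ∃ b', b = b' + 1 := ⟨b - 1, by omega⟩
  simp only [Nat.add_sub_cancel] at h1 h2
  have hacN : a * c ≤ N := le_trans (Nat.le_add_right _ _) h2
  have hb' : b' ≤ (N - a * c) / c := by
    rw [Nat.le_div_iff_mul_le hc]
    omega
  calc a * (b' + 1) * c = a * c * (1 + b') := by ring
    _ ≤ a * c * (1 + (N - a * c) / c) := by gcongr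
    _ ≤ B := hB a c ha hac hacN

/-- Reduction of the exact-cap hypothesis to a bounded (decidable) check: `m ≤ K` with `N < (K+1)²`, `M ≤ N`. -/
theorem exact_hyp_of_bounded (N B K : ℕ) (hK : N < (K + 1) * (K + 1))
    (h : ∀ m : ℕ, m < K + 1 → ∀ M : ℕ, M < N + 1 →
      1 ≤ m → m ≤ M → m * M ≤ N → m * M * (1 + (N - m * M) / M) ≤ B) :
    ∀ m M : ℕ, 1 ≤ m → m ≤ M → m * M ≤ N → m * M * (1 + (N - m * M) / M) ≤ B := by
  intro m M hm hmM hN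
  refine h m ?_ M ?_ hm hmM hN
  · by_contra hK'
    push Not at hK'
    have : (K + 1) * (K + 1) ≤ m * M := Nat.mul_le_mul (by omega) (by omega)
    omega
  · have : M ≤ m * M := Nat.le_mul_of_pos_left M hm
    omega

/-- **Exact cap with the sharper wall** for rank-1 separation in `GL_2(𝔽_p)`. -/
theorem volume_le_exact_dim (hsep : RankSep 1 X Y Z) (B : ℕ)
    (hB : ∀ m M : ℕ, 1 ≤ m → m ≤ M → m * M ≤ (p + 1) * (p ^ 2 - 1) - p →
      m * M * (1 + ((p + 1) * (p ^ 2 - 1) - p - m * M) / M) ≤ B) :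
    X.card * Y.card * Z.card ≤ B := by
  obtain hX | ⟨x₁, hx₁⟩ := X.eq_empty_or_nonempty
  · simp [hX]
  obtain hY | ⟨y₁, hy₁⟩ := Y.eq_empty_or_nonempty
  · simp [hY]
  obtain hZ | ⟨z₁, hz₁⟩ := Z.eq_empty_or_nonempty
  · simp [hZ]
  exact cube_cap_exact _ _ _ _ B (neumann_X_dim hsep hy₁ hz₁) (neumann_Z_dim hsep hx₁ hy₁) hB

/-- **Cell `GL_2(𝔽_2) ≅ S_3`, level 1, is dead modulo the budget**: wall `7`, `V ≤ 9 = B₃(2)` (in fact `8`),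
so `V > budget ≥ 9` is impossible. -/
theorem not_beatsCubes_GL2_level1_two_of_budget [Fact (2 : ℕ).Prime] (hB : LevelOneBudgetLB 2)
    {X Y Z : Finset (GLm 2 2)} (hsep : RankSep 1 X Y Z) : ¬ budget 2 2 1 3 < volume X Y Z := by
  intro hlt
  have hV : X.card * Y.card * Z.card ≤ 9 :=
    volume_le_exact_dim hsep 9 (exact_hyp_of_bounded 7 9 2 (by norm_num) (by decide +kernel))
  unfold LevelOneBudgetLB at hB
  have hV' : volume X Y Z ≤ 9 := by unfold volume; exact_mod_cast hV
  norm_num at hB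
  linarith

/-- **Cell `GL_2(𝔽_7)`, level 1, is dead modulo the budget** — the last cell the counting method reaches:
wall `377 = 8·48 − 7`, exact cap `V ≤ 11·11·24 = 2904 = B₃(7)`, so `V > budget ≥ 2904` is impossible. -/
theorem not_beatsCubes_GL2_level1_seven_of_budget [Fact (7 : ℕ).Prime] (hB : LevelOneBudgetLB 7)
    {X Y Z : Finset (GLm 7 2)} (hsep : RankSep 1 X Y Z) : ¬ budget 7 2 1 3 < volume X Y Z := by
  intro hlt
  have hV : X.card * Y.card * Z.card ≤ 2904 :=
    volume_le_exact_dim hsep 2904 (exact_hyp_of_bounded 377 2904 19 (by norm_num) (by decide +kernel))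
  unfold LevelOneBudgetLB at hB
  have hV' : volume X Y Z ≤ 2904 := by unfold volume; exact_mod_cast hV
  norm_num at hB
  linarith

end DimBound

/-! ## Analysis (for the provers): why the crux resists, and where a kill could come from

**Shape of any witness.** `m ≥ 2`, `1 ≤ k` (`two_le_of_witness`); `k ≥ m` is the full-budget problem
(`topLevel_slice_iff`), so the live content is `1 ≤ k < m`.  The declared first rung is `(m, k) = (2, 1)`.

**The `(2,1)` cell, structure.**  `F_1|_G = span{g ↦ [g u = w] : u, w ∈ 𝔽_p² ∖ 0}` (frame-token form;
`⊇` by Fourier expansion in `v` of `ψ(vᵀ g u)`, `⊆` by `rk M ≤ 1 ⇒ M = u vᵀ`, cf. `exists_vecMulVec_of_rank_le_one`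
and `trace_vecMulVec_mul`) = the matrix-coefficient space of the multiplicity-free permutation module
`W = ℂ[𝔽_p² ∖ 0] = ⊕_θ Ind_B^G(θ ⊗ 1)`; `A := ℂ[G]/F_1^⊥ ≅ ℂ ⊕ M_p ⊕ (p−2)·M_{p+1}`,
`D = dim = p³ + p² − 3p − 1` (`= (p+1)(p²−1) − 2p`: the `2p` relations are `Σ_w [g u = w] = 1` per
direction and `Σ_ℓ Σ_{w ∈ L} [g u_ℓ = w] = 1` per line `L`), `B₃ = p⁴ + 2p³ − 3p² − 5p − 1 = |G|(1 + 3/p + O(p⁻²))`.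
MATROID CRITERION: `(X, Y, Z)` is rank-1 separated iff TPP holds and every target `t ∈ X⁻¹Z` is a COLOOP
of the linear matroid `{π_W(q) : q ∈ Q}`, `Q = X⁻¹YY⁻¹Z` — equivalently no circuit `S` (minimal support
of an element of `F_1^⊥`) satisfies `t ∈ S ⊆ Q`.  Known circuits: `4(p−1)` elements inside `N(T)`
(`{g ∈ T : det g ∈ {c, c'}} ∪ {g ∈ wT : −det g ∈ {c, c'}}`, signs `±`), `4(p+1)` inside `N(T_ns)`, and the
`4p²`-element LDU rectangles `U⁻·diag({a,a'} × {d,d'})·U⁺` used in `not_rankSep_borelConfiguration`; every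
circuit has `≥ p + 3` elements.  Consequences: `|X||Z| + rk π(Q ∖ T) ≤ D` (the graded Neumann count lower-bounds
the second term by `max(|X|,|Z|)(|Y|−1)` only), slice conditions `1 ∉ span π(YY⁻¹ ∖ 1)` and
`Z ⊆ coloops(Y y₀⁻¹ Z)` for every `y₀`.  Feasible shapes at `p = 11` (`D = 1418`, `B₃ = 16884`):
`|X| = |Z| ∈ [14, 29]`, `|Y| ∈ [28, 80]`, e.g. `(22, 35..43, 22)` — all three sets of size `Θ(p^{3/2})`.

**Why natural designs tie at exponent 3.**  For `X ⊆ B⁻`, `Z ⊆ B`, `Y` in a torus (the only hosts of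
`p^{3/2}`-size pieces), `g ∈ Q(X)Q(Z)` is decided by `(g₁₁, det g/g₁₁)`, and the expected number of TPP
violations of `Q(Y)` is `≈ |Q(X)||Q(Y)||Q(Z)|/p⁴ ≥ V/p⁴`: beating `B₃ ≈ p⁴` is exactly where random-like
quotient sets must fail, so a witness needs ARITHMETIC structure (near-subgroups `U⁻ ⋊ μ_d`, `μ_d` of order
`≈ √p`, and a `Y` of size `≈ p^{3/2}` whose quotients avoid `{g₁₁ ∈ μ_d, det/g₁₁ ∈ μ_{d'}}`).  All
subgroup triples have `V ≤ |G| < B₃`; the parabolic ones tie at leading order and are not even separated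
(this file).  No construction with `V > |G|` under TPP alone is known in `GL_2(𝔽_p)`.

**What a kill of the `(2,1)` rung for all `p` would need.**  Either (i) a rank lower bound
`rk π(Q ∖ T) ≥ D − o(p³)` whenever `V > p⁴` (i.e. off-target quadruple products span almost all of `A`), or
(ii) a graded mixing inequality `V ≲ D^{3/2}/√d_min` for `J = F_1` (`d_min = p`; true for `J = ℂ^G` by
BCGPU 2023 Thm 3.2, unknown for proper `J`), or (iii) exhaustion of the structured families plus a
structure theorem forcing them.  (i)–(ii) are open; (iii) is what the kit jobs probe.

**Computations queued this session** (kit, `--workitem stmt-MatrixMultiplication-14057`, exact mod-prime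
sketched rank oracle `comp/gl2sep.py`; results are attached to the item and folded in here on delivery):
j010910 self-test (`dim F_1|_G = D`, `(U⁻,T₁,U⁺)` separated?, `(U⁻,T,U⁺)` / `(Aff⁺,T₂,U⁻)` not);
j010922 / j010930 / j010935 randomized maximal separated triples at `p = 3, 5, 7` (estimates of `V_max`);
j010944 structured `(X, Z)` subgroup pairs with greedy-maximal `Y` at `p = 7`; j010934 the same at the first
live cell `p = 11` (a `Y` with `|Y| ≥ 35` for `X = Z⁻ᵀ = U⁻ ⋊ μ₂` would be a WITNESS of the crux); j010946 at
`p = 13`.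
-/

end Summit.MatrixMultiplication.MatrixMultiplication.Cruxes.LieRankBeatsCubes.Disproof

end
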